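import Summits.QuantumFields.YangMills.Theorems.BalabanUVNodesN20HybridClassLawBudget
import Mathlib.Analysis.Convex.SpecificFunctions.Basic
import Mathlib.Analysis.Convex.Jensen
import Mathlib.Analysis.SpecialFunctions.Log.Deriv
import Mathlib.Analysis.Calculus.MeanValue
import Mathlib.Analysis.Complex.Liouville
import Literature.MathematicalPhysics.QuantumFieldTheory.Balaban1983to89.T4DilationKPLog

/-!
# `hellinger-free-energy-road` — the Sketch (crux idea on K3⁷ `SpineGivenEndpointR13SepCoPH`, stmt-QuantumFields-20544)

Seat `ym-nodeO-idea-3` (ideator, lens «complete», gen 10; EDITION 2 = §10 added gen 11, 2026-08-28, answering CRIT-1's triage sheet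
`CRIT-1-TRIAGE-hellinger-free-energy-road.md`; EDITION 3 = §11–§12 added gen 12, 2026-08-28, after CRIT-1 g5's ed.2 sheet
`CRIT-1-TRIAGE-hellinger-free-energy-road-ed2.md` (SURVIVES priced; its optional ask §2(c) — halve `mixture_moment_le`'s constant — is done):
the card's FIRST UNCHECKED LEMMA is now PROVED and composed BY NAME with §10 and with the tree's Kotecký–Preiss kernel `T4DilationKPLog`, the
representation hypothesis is DERIVED from multiplicative class weights + additive increment, and the V-side is SUMMED OVER KEYS; EDITION 4 = §13 added gen 13, 2026-08-28, after CRIT-1 g5's ed.3 sheet `CRIT-1-TRIAGE-hellinger-free-energy-road-ed3.md` — its finding F-ed3-1 (the tilt letter of §11's one-`(K,t)` kernel and of §12's K-summation was stated on the FULL class laws, where the wild set is idle and the letter is unsuppliable) is CONCEDED and its certified repair R2 «tame conditioning» (`Crit1ProbeIdea3g12.lean`) ADOPTED: §13 re-proves R2 against this file's `bc` and re-states both theorems with the tilts on the TAME-RESTRICTED class sums).  A SCRATCH KERNEL for the idea card `Ideas/hellinger-free-energy-road.md`: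
the finite-sum calculus of the HELLINGER AFFINITY (Bhattacharyya coefficient, Rényi-½) of the two runs' normalised CLASS LAWS at a
key, i.e. the functional the card proposes as the currency of `stub_expansion13H` in place of the five dial binders of `HybridNE7`.

What is checked here (all [folklore] real analysis on finite sums; 0 `sorry`):
* §1 `bc`, `l1`; Cauchy–Schwarz `bc ≤ √ΣA·√ΣB` (log-convexity of `s ↦ log Σ_τ A^{1−s}B^s` at the midpoint), `bc ≤ 1` for laws;
* §2 LE CAM both ways: `1 − bc ≤ ½‖p−q‖₁ ≤ √(1 − bc²) ≤ √(2(1−bc))`; the set form `‖p−q‖₁ ≤ 2b` from `∀ S ⊆ T, p(S) − q(S) ≤ b`;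
* §3 RANGE-FREE second-order modulus `1 − bc ≤ ½ Σ (p−q)²∕(p+q)` (triangular discrimination; no `e^{2R}` range constant) and the
  WILD∕TAME split `1 − bc ≤ ½(p(W)+q(W)) + ½ Σ_{T∖W} (p−q)²∕(p+q)` (wild classes cost their mass — no bad-class dial);
* §4 DATA PROCESSING under coarsening of the key (`bc` increases, `‖·‖₁` decreases along any fibre map) — descent to a coarser key is free;
* §5 TENSORISATION `bc(p⊗p′, q⊗q′) = bc(p,q)·bc(p′,q′)` and the Bernoulli block (Kakutani mechanism behind the `n_K → ∞` caricature);
* §6 the free-energy reading `bc(normalised) = exp(−Δ)`, `Δ = ½log ΣA + ½log ΣB − log Σ√(AB)`, `Δ ≥ 0`;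
* §6b the CLASS-LEVEL Gibbs–Bogoliubov sandwich `⟨h⟩_A ≤ log ΣB − log ΣA ≤ ⟨h⟩_B` (`h = log B − log A`, Jensen) and its consequence for the
  target: matching-mod-constants radius `≤` RESPONSE of the run-A mean increment to the source `+ 2·`WIDTH (`⟨h⟩_B − ⟨h⟩_A`);
* §7 LINK TO THE TREE: `HybridNE7 …` (any six dials) ⇒ `‖p_K − q_K‖₁ ≤ 2·budget_K` and `1 − bc_K ≤ budget_K := 2(W_K+Wsh_K)+2|vol·δ_K|`,
  hence `Summable (1 − bc_K)` along every admissible source selection — via dag-n20-w4's p607565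
  `N20HybridClassLawBudget.abs_classLaw_sub_classLaw_le_of_hybridNE7 ∕ summable_budget_of_hybridNE7` BY NAME (NECESSITY); and the
  SUFFICIENCY direction: `classLawTV_of_hellinger` turns a Hellinger-type radius `√(1 − bc_K(t)²) ≤ ρ_K` into EXACTLY the per-set TV hypothesis
  `∀ K t, |t| ≤ l₀ → ∀ S ⊆ T K, |Σ_S A∕Σ_T A − Σ_S B∕Σ_T B| ≤ ρ_K` of dag-n20-w4's CLAIM-2 road
  `N20HybridClassLawCharacterisation.exists_hybridNE7_of_target_of_classLawTV` (landed 2026-08-28T06:11Z; not imported here only because the farm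
  had not yet built it at check time) — so `Target ∧ Σρ_K < ∞ ∧ ρ_K < 1 ⇒ ∃ shA shB, HybridNE7 … ∅ 0 shA shB ρ δ` is one application away;
* §8 the window-threshold comparison `log(1∕θ)∕(log(1∕θ)+2 log L) > log(1∕θ)∕(log(1∕θ)+4 log L)`;
* §10 (EDITION 2, the ENDPOINT ROAD — CRIT-1 §5 answered structurally: no interpolated ensemble `μ_s` on the load-bearing path):
  the Padé bound `2(s−1)∕(s+1) ≤ log s` ⇒ `(a−b)²∕(a+b) ≤ ¼(a+b)(log a − log b)²` ⇒ `1 − bc ≤ ½(p(W)+q(W)) + ⅛Σ_{T∖W}(p+q)(log p − log q)²`,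
  and for class weights `log p − log q = −(h − c)` (`h = log B − log A`, `c = log Z_B − log Z_A`): the V-supply is WILD MASS + the SECOND MOMENT OF
  THE CENTRED TWO-RUN INCREMENT UNDER THE MIXTURE `½(p+q)` OF THE TWO ONE-RUN CLASS LAWS (`one_sub_bc_classLaw_le_wild_add_moment`); the COUPLING
  LEMMA `|E_q f − E_p f| ≤ 2√(2(1−bc))·√(Σ½(p+q)(f−c)²)` (`abs_sum_sub_sum_le_hellinger`); the MOMENT BOOTSTRAP `M ≤ ½(Var_p h + Var_q h) + 4(1−bc)M`
  (`mixture_moment_le`, so `M ≤ Var_p h + Var_q h` once `1 − bc ≤ 1∕16`: two ONE-RUN variances of the two-run observable `h`); the ENDPOINT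
  RESPONSE IDENTITY `d∕dt[log Z_B − log Z_A] = E_q[∂h] + (E_q − E_p)[j]`, `j = A'∕A` (`hasDerivAt_log_sum_sub_log_sum`, `response_split`), its
  one-`(K,t)` bound `|c'| ≤ |E_q ∂h| + 2√(2(1−bc))·σ_{½(p+q)}(j)` (`abs_response_le`) and the mean-value step to the `MatchingModConstants` shape
  (`matching_of_derivative_bound`).
* §11 (EDITION 3, the ONE-RUN VARIANCE SUPPLY — the card's First lemma, CHECKED): `variance_le_of_analytic_tilt` — if the TILTED CLASS
  FREE ENERGY `φ(s)`, `e^{φ(s)} = Σ_τ A_τ e^{s h_τ}∕Σ_τ A_τ`, has an analytic branch on the closed disc `|s| ≤ r` with `|φ| ≤ B` there, then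
  `Var_{A∕Z_A}(h) = φ″(0) ≤ 4B∕r²` (log-derivative identity + two Cauchy estimates on radius `r∕2`; the ed.2 hypothesis `φ 0 = 0` is automatic and
  dropped); SCALING `h = η·u` ⇒ `Var ≤ 4Bη²∕r₀²` (`variance_le_of_analytic_tilt_scaled`: the two-run size `η` of the increment enters ONLY through
  the radius, QUADRATICALLY); the KOTECKÝ–PREISS PROVIDER BY NAME (`variance_le_of_kpTilt`): if the tilted class sum is a ratio of polymer partition
  functions `cZ inc w Λ s ∕ cZ inc w Λ 0` whose activities are holomorphic and uniformly KP on the disc (`T4DilationKP.IsKPOn`), then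
  `Var ≤ 8(Σ_γ a γ)∕r²` (tree `T4DilationKPLog.logZ_differentiableOn_and_bound` + `exp_polymerLogZ_of_kp`); and the ONE-`(K,t)` V-SIDE KERNEL
  `one_sub_bc_classLaw_le_wild_add_tilts`: in the perturbative regime `1 − bc ≤ 1∕16` (itself supplied by `regime_of_wild_add_sup`: wild mass `≤ 3∕64`
  and `sup_{tame} |h − c| ≤ ¼`) the Hellinger defect of the two runs' class laws is `≤ ½(p(W)+q(W)) + (B_A + B_B)∕r²` — wild mass plus the two
  runs' tilt bounds, the centring `c = log Z_B − log Z_A` discharged by §6b `gibbs_bogoliubov_sandwich`;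
* §12 (EDITION 3, STRUCTURE ⇒ REPRESENTATION and the K-SUMMATION): `tilt_classSum_eq_cZ` — if a run's keyed classes are the compatible
  sub-families of a finite polymer family `Λ` (its large-field components), with MULTIPLICATIVE class weights `A_X = ∏_{γ∈X} a_γ` and an ADDITIVE
  increment `h_X = Σ_{γ∈X} u_γ`, the tilted class sum IS the polymer partition function `T4DilationKP.cZ` of the entire activities `a_γ e^{s u_γ}`
  (so `variance_le_of_kpTilt`'s `hrep` is an IDENTITY, not a hypothesis); `isKPOn_tilt` — a WEIGHTED real KP condition
  `Σ_{γ'∼γ} a_γ' e^{r|u_γ'|} e^{asz γ'} ≤ asz γ` gives `IsKPOn` on `|s| ≤ r` (the run's own margin absorbs `e^{r|u|}`; with `|u_γ| ≤ η·size γ`,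
  `r = r₀∕η` this is `e^{r₀·size γ}` — `η` is spent on the radius only); the composition `variance_le_of_multiplicative_kp`
  (`Var ≤ 8(Σ asz)∕r²` from ONE run's activities, their KP margin and the local sizes of the increment); and `hellingerRate_of_tilts` — per-key
  wild masses (`Σ√w_K < ∞`), radii (`Σ 1∕r_K < ∞`, i.e. `Ση_K < ∞`), one tilt bound `𝔅` and the coarse regime from `K₀` on give a SUMMABLE
  `ρ_K = √w_K + √(2𝔅)∕r_K (+1 on K < K₀)` with `√(1 − bc_K(t)) ≤ ρ_K` for all `K`, `|t| ≤ l₀` — the input shape of §7 `classLawTV_of_hellinger` ∕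
  the landed per-set-TV road.  HONEST: `Σ√w_K < ∞` and `Ση_K < ∞` are the UNPRINTED letters ((V-a) one-run [rider R1], (V-b) = (YG) two-run);
  §12 shows only that the V-side consumes NO OTHER letter.
* §13 (EDITION 4, TAME CONDITIONING — CRIT-1 g5 rider R2): `one_sub_bc_le_wildMass_add_tame` — for laws `p, q` on `T`, `W ⊆ T` with positive
  tame masses, `1 − bc_T(p,q) ≤ max(p(W), q(W)) + (1 − bc_{T∖W}(p∕p(T∖W), q∕q(T∖W)))` (CRIT-1's certified lemma, re-proved here);
  `classLaw_condition_eq_restrict` — conditioning a class law on the tame classes IS the class law of the restricted weights; the TAME-CONDITIONED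
  one-`(K,t)` kernel `one_sub_bc_classLaw_le_wildMass_add_tameTilts`: `1 − bc_T ≤ max(p(W), q(W)) + (B_A + B_B)∕r²` from analytic tilts of the
  RESTRICTED sums `Σ_{T∖W} A e^{sh}∕Σ_{T∖W} A`, `Σ_{T∖W} B e^{sh}∕Σ_{T∖W} B` only (regime `1 − bc_{T∖W} ≤ 1∕16`, supplied by `regime_tame_of_sup`);
  and the K-SUMMATION `hellingerRate_of_tameTilts`: per-key ONE-RUN over-aged masses `p_K(W_K), q_K(W_K) ≤ w_K` (`Σ√w_K < ∞`), radii `r_K`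
  (`Σ1∕r_K < ∞`), one tilt bound `𝔅` ON THE TAME SUMS and the tame regime from `K₀` on ⇒ summable `ρ_K = √w_K + √(2𝔅)∕r_K (+ head)` with
  `√(1 − bc_K(t)) ≤ ρ_K` — the wild classes enter ONLY through their one-run masses (letter (V‑a)); for multiplicative keyed weights the tame
  restricted sums are `cZ` over the NON-over-aged polymers (`tilt_classSum_eq_cZ` with `Λ ↦ Λ∖(over-aged)`), where `|u_γ| ≤ η_K·size γ` = (V‑b)
  holds, so §12's `isKPOn_tilt` ∕ `variance_le_of_multiplicative_kp` supply the tame tilt letter and NO new letter enters the bill.  The full-law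
  theorems of §11–§12 stay (true, but their tilt hypothesis is not the supplied one — superseded as the load-bearing statements by §13).
NOT checked here (prose in the card, marked there; NO LONGER LOAD-BEARING after §10): the variational identity `Δ = ∫₀¹ G(s)·Var_{μ_s}(h) ds ≤
⅛ sup_s Var_{μ_s}(h)` along the interpolated ensemble — standard thermodynamic-integration calculus, cited not kernel-checked.

HONEST FRAMING.  Nothing here proves or approaches the Yang–Mills mass gap (Clay): NOT proved.  Route R4's `closes` is the CONDITIONAL
finite-𝕋⁴ rung `BalabanLadder.UV` only; [B12] Thm 2 is unproved in print; NE7∕NE7b∕NE7c are not printed as two-run statements for d = 4.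
This file decides no route item; it is evidence for a crux IDEA, filed under `Cruxes/SpineGivenEndpointR13SepCoPH/`.
-/

noncomputable section

namespace YMNodeOIdeate.Idea3.HellingerRoad

open Finset Filter
open Literature.MathematicalPhysics.QuantumFieldTheory.Balaban1983to89
open T4MatchingAssembly (HybridNE7)
open Summit.QuantumFields.YangMills.BalabanUVNodes.N20HybridClassLawBudget
  (abs_classLaw_sub_classLaw_le_of_hybridNE7 summable_budget_of_hybridNE7)

variable {ι : Type*}

/-! ## §1 Bhattacharyya coefficient ∕ Hellinger affinity and ℓ¹ distance of two weights on a finite class set -/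

/-- `bc T p q := Σ_{τ ∈ T} √(p τ · q τ)` — for normalised `p, q` the Hellinger affinity `ρ_{1/2}(p,q)`; for unnormalised class weights
`A, B` the midpoint partition function `Z(½) = Σ_τ A^{1/2} B^{1/2}` of the interpolated class ensemble. -/
def bc (T : Finset ι) (p q : ι → ℝ) : ℝ := ∑ τ ∈ T, Real.sqrt (p τ * q τ)

/-- `l1 T p q := Σ_{τ ∈ T} |p τ − q τ|` (twice the total-variation distance when `p, q` are laws). -/
def l1 (T : Finset ι) (p q : ι → ℝ) : ℝ := ∑ τ ∈ T, |p τ - q τ|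

section Laws
variable {T : Finset ι} {p q : ι → ℝ}

theorem bc_nonneg : 0 ≤ bc T p q := sum_nonneg fun _ _ => Real.sqrt_nonneg _

theorem l1_nonneg : 0 ≤ l1 T p q := sum_nonneg fun _ _ => abs_nonneg _

/-- CAUCHY–SCHWARZ [folklore]: `Σ√(pq) ≤ √(Σp)·√(Σq)` — i.e. `Z(½)² ≤ Z(0)·Z(1)`, log-convexity of the interpolated free energy at the midpoint. -/
theorem bc_le_sqrt_mul_sqrt (hp : ∀ τ ∈ T, 0 ≤ p τ) (hq : ∀ τ ∈ T, 0 ≤ q τ) :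
    bc T p q ≤ Real.sqrt (∑ τ ∈ T, p τ) * Real.sqrt (∑ τ ∈ T, q τ) := by
  have h := Real.sum_mul_le_sqrt_mul_sqrt T (fun τ => Real.sqrt (p τ)) (fun τ => Real.sqrt (q τ))
  have e1 : ∑ τ ∈ T, Real.sqrt (p τ) ^ 2 = ∑ τ ∈ T, p τ := sum_congr rfl fun τ hτ => Real.sq_sqrt (hp τ hτ)
  have e2 : ∑ τ ∈ T, Real.sqrt (q τ) ^ 2 = ∑ τ ∈ T, q τ := sum_congr rfl fun τ hτ => Real.sq_sqrt (hq τ hτ)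
  have e0 : bc T p q = ∑ τ ∈ T, Real.sqrt (p τ) * Real.sqrt (q τ) :=
    sum_congr rfl fun τ hτ => Real.sqrt_mul (hp τ hτ) _
  rw [e0, ← e1, ← e2]
  exact h

/-- For laws (`Σp = Σq = 1`): `bc ≤ 1`. [folklore] -/
theorem bc_le_one (hp : ∀ τ ∈ T, 0 ≤ p τ) (hq : ∀ τ ∈ T, 0 ≤ q τ) (hp1 : ∑ τ ∈ T, p τ = 1) (hq1 : ∑ τ ∈ T, q τ = 1) :
    bc T p q ≤ 1 := by
  have h := bc_le_sqrt_mul_sqrt hp hq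
  rw [hp1, hq1, Real.sqrt_one, mul_one] at h
  exact h

/-- `Σ(√p − √q)² = Σp + Σq − 2·bc` (twice the squared Hellinger distance for laws). [folklore] -/
theorem sum_sq_sqrt_sub (hp : ∀ τ ∈ T, 0 ≤ p τ) (hq : ∀ τ ∈ T, 0 ≤ q τ) :
    ∑ τ ∈ T, (Real.sqrt (p τ) - Real.sqrt (q τ)) ^ 2 = ∑ τ ∈ T, p τ + ∑ τ ∈ T, q τ - 2 * bc T p q := by
  unfold bc
  rw [mul_sum, ← sum_add_distrib, ← sum_sub_distrib]
  refine sum_congr rfl fun τ hτ => ?_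
  rw [Real.sqrt_mul (hp τ hτ), sub_sq, Real.sq_sqrt (hp τ hτ), Real.sq_sqrt (hq τ hτ)]
  ring

/-- `Σ(√p + √q)² = Σp + Σq + 2·bc`. [folklore] -/
theorem sum_sq_sqrt_add (hp : ∀ τ ∈ T, 0 ≤ p τ) (hq : ∀ τ ∈ T, 0 ≤ q τ) :
    ∑ τ ∈ T, (Real.sqrt (p τ) + Real.sqrt (q τ)) ^ 2 = ∑ τ ∈ T, p τ + ∑ τ ∈ T, q τ + 2 * bc T p q := by
  unfold bc
  rw [mul_sum, ← sum_add_distrib, ← sum_add_distrib]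
  refine sum_congr rfl fun τ hτ => ?_
  rw [Real.sqrt_mul (hp τ hτ), add_sq, Real.sq_sqrt (hp τ hτ), Real.sq_sqrt (hq τ hτ)]
  ring

/-! ## §2 Le Cam's inequalities: Hellinger affinity controls, and is controlled by, total variation [folklore: Ghosal–van der Vaart Lemma B.1] -/

/-- `|a − b| = |√a − √b|·(√a + √b)` for `a, b ≥ 0`. [folklore] -/
theorem abs_sub_eq_abs_sqrt_sub_mul {a b : ℝ} (ha : 0 ≤ a) (hb : 0 ≤ b) :
    |a - b| = |Real.sqrt a - Real.sqrt b| * (Real.sqrt a + Real.sqrt b) := by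
  have h : a - b = (Real.sqrt a - Real.sqrt b) * (Real.sqrt a + Real.sqrt b) := by
    have ha' := Real.sq_sqrt ha
    have hb' := Real.sq_sqrt hb
    linear_combination (-1 : ℝ) * ha' + hb'
  rw [h, abs_mul, abs_of_nonneg (add_nonneg (Real.sqrt_nonneg a) (Real.sqrt_nonneg b))]

/-- LE CAM, upper form [folklore]: `‖p − q‖₁ ≤ √(Σ(√p−√q)²)·√(Σ(√p+√q)²)`. -/
theorem l1_le_sqrt_mul_sqrt (hp : ∀ τ ∈ T, 0 ≤ p τ) (hq : ∀ τ ∈ T, 0 ≤ q τ) :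
    l1 T p q ≤ Real.sqrt (∑ τ ∈ T, (Real.sqrt (p τ) - Real.sqrt (q τ)) ^ 2)
      * Real.sqrt (∑ τ ∈ T, (Real.sqrt (p τ) + Real.sqrt (q τ)) ^ 2) := by
  have h := Real.sum_mul_le_sqrt_mul_sqrt T (fun τ => |Real.sqrt (p τ) - Real.sqrt (q τ)|)
    (fun τ => Real.sqrt (p τ) + Real.sqrt (q τ))
  have e0 : l1 T p q = ∑ τ ∈ T, |Real.sqrt (p τ) - Real.sqrt (q τ)| * (Real.sqrt (p τ) + Real.sqrt (q τ)) :=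
    sum_congr rfl fun τ hτ => abs_sub_eq_abs_sqrt_sub_mul (hp τ hτ) (hq τ hτ)
  have e1 : ∑ τ ∈ T, |Real.sqrt (p τ) - Real.sqrt (q τ)| ^ 2 = ∑ τ ∈ T, (Real.sqrt (p τ) - Real.sqrt (q τ)) ^ 2 :=
    sum_congr rfl fun τ _ => sq_abs _
  rw [e0, ← e1]
  exact h

/-- **LE CAM (laws)** [folklore]: `‖p − q‖₁ ≤ 2·√(1 − bc²)`; in particular the TV radius `½‖p−q‖₁ < 1` as soon as `bc > 0`. -/
theorem l1_le_two_sqrt_one_sub_bc_sq (hp : ∀ τ ∈ T, 0 ≤ p τ) (hq : ∀ τ ∈ T, 0 ≤ q τ)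
    (hp1 : ∑ τ ∈ T, p τ = 1) (hq1 : ∑ τ ∈ T, q τ = 1) :
    l1 T p q ≤ 2 * Real.sqrt (1 - bc T p q ^ 2) := by
  have h := l1_le_sqrt_mul_sqrt hp hq
  rw [sum_sq_sqrt_sub hp hq, sum_sq_sqrt_add hp hq, hp1, hq1] at h
  have hb1 := bc_le_one hp hq hp1 hq1
  have h2 : Real.sqrt (1 + 1 - 2 * bc T p q) * Real.sqrt (1 + 1 + 2 * bc T p q) = 2 * Real.sqrt (1 - bc T p q ^ 2) := by
    rw [← Real.sqrt_mul (by linarith)]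
    have : (1 + 1 - 2 * bc T p q) * (1 + 1 + 2 * bc T p q) = 2 ^ 2 * (1 - bc T p q ^ 2) := by ring
    rw [this, Real.sqrt_mul (by norm_num), Real.sqrt_sq (by norm_num)]
  exact h.trans (le_of_eq h2)

/-- `min a b ≤ √(ab)` for `a, b ≥ 0`. [folklore] -/
theorem min_le_sqrt_mul {a b : ℝ} (ha : 0 ≤ a) (hb : 0 ≤ b) : min a b ≤ Real.sqrt (a * b) := by
  refine Real.le_sqrt_of_sq_le ?_
  rcases le_total a b with h | h
  · rw [min_eq_left h]; nlinarith
  · rw [min_eq_right h]; nlinarith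

/-- **LE CAM (laws), lower form** [folklore]: `1 − bc ≤ ½‖p − q‖₁` (`Σ min(p,q) ≤ Σ√(pq)`). -/
theorem one_sub_bc_le_half_l1 (hp : ∀ τ ∈ T, 0 ≤ p τ) (hq : ∀ τ ∈ T, 0 ≤ q τ)
    (hp1 : ∑ τ ∈ T, p τ = 1) (hq1 : ∑ τ ∈ T, q τ = 1) :
    1 - bc T p q ≤ l1 T p q / 2 := by
  have hmin : ∀ τ ∈ T, min (p τ) (q τ) = (p τ + q τ - |p τ - q τ|) / 2 := fun τ _ => by
    rcases le_total (p τ) (q τ) with h | h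
    · rw [min_eq_left h, abs_of_nonpos (sub_nonpos.2 h)]; ring
    · rw [min_eq_right h, abs_of_nonneg (sub_nonneg.2 h)]; ring
  have h1 : ∑ τ ∈ T, min (p τ) (q τ) = (1 + 1 - l1 T p q) / 2 := by
    unfold l1
    rw [sum_congr rfl hmin, ← sum_div, sum_sub_distrib, sum_add_distrib, hp1, hq1]
  have h2 : ∑ τ ∈ T, min (p τ) (q τ) ≤ bc T p q :=
    sum_le_sum fun τ hτ => min_le_sqrt_mul (hp τ hτ) (hq τ hτ)
  linarith

/-- Consequence used downstream [folklore]: `‖p − q‖₁ ≤ 2√2·√(1 − bc)`, so `Σ_K √(1 − bc_K) < ∞ ⇒ Σ_K ‖p_K − q_K‖₁ < ∞`. -/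
theorem l1_le_two_sqrt_two_mul_one_sub_bc (hp : ∀ τ ∈ T, 0 ≤ p τ) (hq : ∀ τ ∈ T, 0 ≤ q τ)
    (hp1 : ∑ τ ∈ T, p τ = 1) (hq1 : ∑ τ ∈ T, q τ = 1) :
    l1 T p q ≤ 2 * Real.sqrt (2 * (1 - bc T p q)) := by
  have h := l1_le_two_sqrt_one_sub_bc_sq hp hq hp1 hq1
  have hb1 := bc_le_one hp hq hp1 hq1
  have hb0 : 0 ≤ bc T p q := bc_nonneg
  have : 1 - bc T p q ^ 2 ≤ 2 * (1 - bc T p q) := by nlinarith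
  exact h.trans (mul_le_mul_of_nonneg_left (Real.sqrt_le_sqrt this) (by norm_num))

/-- The SET form of total variation [folklore]: if the two weights have equal totals and `p(S) − q(S) ≤ b` for every `S ⊆ T`, then
`‖p − q‖₁ ≤ 2b` (take `S = {p > q}`).  This is how dag-n20-w4's class-law budget (stated per `S`) is read as an ℓ¹ bound. -/
theorem l1_le_two_mul_of_forall_subset {b : ℝ} (h : ∀ S, S ⊆ T → ∑ τ ∈ S, p τ - ∑ τ ∈ S, q τ ≤ b)
    (hpq : ∑ τ ∈ T, p τ = ∑ τ ∈ T, q τ) : l1 T p q ≤ 2 * b := by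
  classical
  set S := T.filter (fun τ => q τ < p τ) with hSdef
  have hsplit : l1 T p q = ∑ τ ∈ S, |p τ - q τ| + ∑ τ ∈ T.filter (fun τ => ¬ q τ < p τ), |p τ - q τ| :=
    (sum_filter_add_sum_filter_not T (fun τ => q τ < p τ) _).symm
  have hS : ∑ τ ∈ S, |p τ - q τ| = ∑ τ ∈ S, (p τ - q τ) :=
    sum_congr rfl fun τ hτ => abs_of_pos (sub_pos.2 (mem_filter.1 hτ).2)
  have hSc : ∑ τ ∈ T.filter (fun τ => ¬ q τ < p τ), |p τ - q τ| = ∑ τ ∈ T.filter (fun τ => ¬ q τ < p τ), (q τ - p τ) :=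
    sum_congr rfl fun τ hτ => by
      rw [abs_sub_comm]; exact abs_of_nonneg (sub_nonneg.2 (not_lt.1 (mem_filter.1 hτ).2))
  have hbal : ∑ τ ∈ S, (p τ - q τ) + ∑ τ ∈ T.filter (fun τ => ¬ q τ < p τ), (p τ - q τ) = 0 := by
    rw [sum_filter_add_sum_filter_not, sum_sub_distrib, hpq, sub_self]
  have hneg : ∑ τ ∈ T.filter (fun τ => ¬ q τ < p τ), (q τ - p τ) = - ∑ τ ∈ T.filter (fun τ => ¬ q τ < p τ), (p τ - q τ) := by
    rw [← sum_neg_distrib]; exact sum_congr rfl fun τ _ => by ring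
  have hSb : ∑ τ ∈ S, (p τ - q τ) ≤ b := by rw [sum_sub_distrib]; exact h S (filter_subset _ _)
  linarith [hsplit, hS, hSc, hbal, hneg, hSb]

/-- Conversely [folklore]: with equal totals, every set difference is at most half the ℓ¹ distance, `|p(S) − q(S)| ≤ ½‖p − q‖₁` (`S ⊆ T`). -/
theorem abs_setDiff_le_half_l1 [DecidableEq ι] (hpq : ∑ τ ∈ T, p τ = ∑ τ ∈ T, q τ) {S : Finset ι} (hS : S ⊆ T) :
    |∑ τ ∈ S, p τ - ∑ τ ∈ S, q τ| ≤ l1 T p q / 2 := by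
  have h1 : |∑ τ ∈ S, (p τ - q τ)| ≤ ∑ τ ∈ S, |p τ - q τ| := abs_sum_le_sum_abs _ _
  have h2 : |∑ τ ∈ T \ S, (p τ - q τ)| ≤ ∑ τ ∈ T \ S, |p τ - q τ| := abs_sum_le_sum_abs _ _
  have hsum : ∑ τ ∈ T \ S, (p τ - q τ) + ∑ τ ∈ S, (p τ - q τ) = 0 := by
    rw [sum_sdiff hS, sum_sub_distrib, hpq, sub_self]
  have hl1 : ∑ τ ∈ T \ S, |p τ - q τ| + ∑ τ ∈ S, |p τ - q τ| = l1 T p q := sum_sdiff hS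
  have e : ∑ τ ∈ S, p τ - ∑ τ ∈ S, q τ = ∑ τ ∈ S, (p τ - q τ) := (sum_sub_distrib _ _).symm
  rw [e]
  have h3 : |∑ τ ∈ S, (p τ - q τ)| = |∑ τ ∈ T \ S, (p τ - q τ)| := by
    rw [show ∑ τ ∈ S, (p τ - q τ) = -∑ τ ∈ T \ S, (p τ - q τ) by linarith, abs_neg]
  linarith [h3 ▸ h2]

/-! ## §3 A RANGE-FREE second-order modulus: `1 − bc ≤ ½·Σ (p − q)²∕(p + q)` (triangular discrimination) [folklore]

Compare `T4VarianceMatching` §8 (`∫|e^f∕Z − 1| dν ≤ 2e^{2R}∫|f−κ| dν`, range `R` in the constant): in the Hellinger currency the second-order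
modulus carries NO range constant — `(p−q)²∕(p+q) = (p+q)·tanh²(u∕2)` with `u = log(p∕q)` the (renormalised) two-run log-increment, and `tanh² ≤ 1`. -/

/-- `(√a − √b)² ≤ (a − b)²∕(a + b)` for `a, b ≥ 0` (both sides vanish at `a = b = 0`). [folklore] -/
theorem sq_sqrt_sub_le {a b : ℝ} (ha : 0 ≤ a) (hb : 0 ≤ b) :
    (Real.sqrt a - Real.sqrt b) ^ 2 ≤ (a - b) ^ 2 / (a + b) := by
  rcases (add_nonneg ha hb).eq_or_lt with h0 | hpos
  · have ha0 : a = 0 := by linarith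
    have hb0 : b = 0 := by linarith
    subst ha0; subst hb0; simp
  · rw [le_div_iff₀ hpos]
    have h1 : a - b = (Real.sqrt a - Real.sqrt b) * (Real.sqrt a + Real.sqrt b) := by
      have ha' := Real.sq_sqrt ha
      have hb' := Real.sq_sqrt hb
      linear_combination (-1 : ℝ) * ha' + hb'
    have h2 : a + b ≤ (Real.sqrt a + Real.sqrt b) ^ 2 := by
      nlinarith [Real.sq_sqrt ha, Real.sq_sqrt hb, Real.sqrt_nonneg a, Real.sqrt_nonneg b]
    calc (Real.sqrt a - Real.sqrt b) ^ 2 * (a + b)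
        ≤ (Real.sqrt a - Real.sqrt b) ^ 2 * (Real.sqrt a + Real.sqrt b) ^ 2 :=
          mul_le_mul_of_nonneg_left h2 (sq_nonneg _)
      _ = (a - b) ^ 2 := by rw [h1]; ring

/-- **RANGE-FREE MODULUS** [folklore]: for laws, `1 − bc ≤ ½ Σ_τ (p τ − q τ)²∕(p τ + q τ)` — the squared Hellinger distance is dominated by
the triangular discrimination, a second-order quantity in the two-run misfit with a UNIVERSAL constant. -/
theorem one_sub_bc_le_triangular (hp : ∀ τ ∈ T, 0 ≤ p τ) (hq : ∀ τ ∈ T, 0 ≤ q τ)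
    (hp1 : ∑ τ ∈ T, p τ = 1) (hq1 : ∑ τ ∈ T, q τ = 1) :
    1 - bc T p q ≤ (∑ τ ∈ T, (p τ - q τ) ^ 2 / (p τ + q τ)) / 2 := by
  have h := sum_sq_sqrt_sub hp hq
  rw [hp1, hq1] at h
  have h2 : ∑ τ ∈ T, (Real.sqrt (p τ) - Real.sqrt (q τ)) ^ 2 ≤ ∑ τ ∈ T, (p τ - q τ) ^ 2 / (p τ + q τ) :=
    sum_le_sum fun τ hτ => sq_sqrt_sub_le (hp τ hτ) (hq τ hτ)
  linarith

/-- RANGE‑FREE WILD∕TAME SPLIT [folklore]: for normalised laws and ANY set `W ⊆ T` of "wild" classes (e.g. the classes carrying an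
over‑aged pending region), `1 − bc ≤ ½·(p(W) + q(W)) + ½·Σ_{T∖W} (p−q)²∕(p+q)` — wild classes cost their MASS and nothing more (no bad‑class
dial, no range assumption on the increment there); the tame remainder is the second‑moment `tanh²` form of `sub_sq_div_add_eq_mul_tanh_sq`. -/
theorem one_sub_bc_le_wild_add_tame [DecidableEq ι] (hp : ∀ τ ∈ T, 0 ≤ p τ) (hq : ∀ τ ∈ T, 0 ≤ q τ)
    (hp1 : ∑ τ ∈ T, p τ = 1) (hq1 : ∑ τ ∈ T, q τ = 1) {W : Finset ι} (hW : W ⊆ T) :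
    1 - bc T p q ≤ (∑ τ ∈ W, (p τ + q τ)) / 2 + (∑ τ ∈ T \ W, (p τ - q τ) ^ 2 / (p τ + q τ)) / 2 := by
  have h := one_sub_bc_le_triangular hp hq hp1 hq1
  have hsplit : ∑ τ ∈ T \ W, (p τ - q τ) ^ 2 / (p τ + q τ) + ∑ τ ∈ W, (p τ - q τ) ^ 2 / (p τ + q τ)
      = ∑ τ ∈ T, (p τ - q τ) ^ 2 / (p τ + q τ) := sum_sdiff hW
  have hWle : ∑ τ ∈ W, (p τ - q τ) ^ 2 / (p τ + q τ) ≤ ∑ τ ∈ W, (p τ + q τ) := by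
    refine sum_le_sum fun τ hτ => ?_
    have hpτ := hp τ (hW hτ)
    have hqτ := hq τ (hW hτ)
    rcases (add_nonneg hpτ hqτ).eq_or_lt with h0 | hpos
    · rw [← h0]; simp
    · rw [div_le_iff₀ hpos]; nlinarith [mul_nonneg hpτ hqτ]
  linarith

/-- The log-ratio (two-run increment) form of one term [folklore]: for `a, b > 0`,
`(a − b)²∕(a + b) = (a + b)·tanh²((log a − log b)∕2)`. -/
theorem sub_sq_div_add_eq_mul_tanh_sq {a b : ℝ} (ha : 0 < a) (hb : 0 < b) :
    (a - b) ^ 2 / (a + b) = (a + b) * Real.tanh ((Real.log a - Real.log b) / 2) ^ 2 := by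
  set y := (Real.log a - Real.log b) / 2 with hy
  have hE : Real.exp y ^ 2 = a / b := by
    rw [← Real.exp_nat_mul y 2]
    have : ((2 : ℕ) : ℝ) * y = Real.log a - Real.log b := by rw [hy]; push_cast; ring
    rw [this, Real.exp_sub, Real.exp_log ha, Real.exp_log hb]
  have hpos : 0 < Real.exp y := Real.exp_pos y
  have ht : Real.tanh y = (a - b) / (a + b) := by
    rw [Real.tanh_eq_sinh_div_cosh, Real.sinh_eq, Real.cosh_eq, Real.exp_neg]
    have hab : (0 : ℝ) < a + b := add_pos ha hb
    have hb0 : b ≠ 0 := hb.ne'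
    have he0 : Real.exp y ≠ 0 := hpos.ne'
    -- multiply through by `e^y`: (e^y − e^{−y})/(e^y + e^{−y}) = (e^{2y} − 1)/(e^{2y} + 1) = (a/b − 1)/(a/b + 1)
    have key : (Real.exp y - (Real.exp y)⁻¹) / 2 / ((Real.exp y + (Real.exp y)⁻¹) / 2)
        = (Real.exp y ^ 2 - 1) / (Real.exp y ^ 2 + 1) := by
      field_simp
    rw [key, hE]
    field_simp
  rw [ht, div_pow]
  have hab : (a + b) ≠ 0 := (add_pos ha hb).ne'
  field_simp

/-! ## §4 Data processing: coarsening the key can only INCREASE the affinity and DECREASE the ℓ¹ distance [folklore] -/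

section DPI
variable {κ : Type*} [DecidableEq κ]

/-- push-forward of a weight along a key-coarsening map `f` (sum over the fibre inside `T`). -/
def push (T : Finset ι) (f : ι → κ) (p : ι → ℝ) : κ → ℝ := fun k => ∑ τ ∈ T with f τ = k, p τ

variable {T' : Finset κ} {f : ι → κ}

theorem sum_push (hf : ∀ τ ∈ T, f τ ∈ T') : ∑ k ∈ T', push T f p k = ∑ τ ∈ T, p τ :=
  sum_fiberwise_of_maps_to hf p

theorem push_nonneg (hp : ∀ τ ∈ T, 0 ≤ p τ) (k : κ) : 0 ≤ push T f p k :=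
  sum_nonneg fun τ hτ => hp τ (mem_filter.1 hτ).1

/-- **DATA PROCESSING for the affinity** [folklore]: `bc T p q ≤ bc T' (f_* p) (f_* q)` (fibrewise Cauchy–Schwarz).  Reading: the Hellinger
defect of the two runs' class laws is MONOTONE in the key — a coarser key has a smaller defect, the trivial key has defect 0
(dag-n19-w1's free re-keying descent, in one line; no free ascent). -/
theorem bc_le_bc_push (hf : ∀ τ ∈ T, f τ ∈ T') (hp : ∀ τ ∈ T, 0 ≤ p τ) (hq : ∀ τ ∈ T, 0 ≤ q τ) :
    bc T p q ≤ bc T' (push T f p) (push T f q) := by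
  unfold bc
  rw [← sum_fiberwise_of_maps_to hf (fun τ => Real.sqrt (p τ * q τ))]
  refine sum_le_sum fun k _ => ?_
  have hpk : ∀ τ ∈ T.filter (fun τ => f τ = k), 0 ≤ p τ := fun τ hτ => hp τ (mem_filter.1 hτ).1
  have hqk : ∀ τ ∈ T.filter (fun τ => f τ = k), 0 ≤ q τ := fun τ hτ => hq τ (mem_filter.1 hτ).1
  have h := bc_le_sqrt_mul_sqrt hpk hqk
  unfold bc at h
  have e : Real.sqrt (push T f p k * push T f q k) = Real.sqrt (push T f p k) * Real.sqrt (push T f q k) :=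
    Real.sqrt_mul (push_nonneg hp k) _
  rw [e]
  exact h

/-- **DATA PROCESSING for ℓ¹** [folklore]: `‖f_* p − f_* q‖₁ ≤ ‖p − q‖₁`. -/
theorem l1_push_le (hf : ∀ τ ∈ T, f τ ∈ T') : l1 T' (push T f p) (push T f q) ≤ l1 T p q := by
  unfold l1
  rw [← sum_fiberwise_of_maps_to hf (fun τ => |p τ - q τ|)]
  refine sum_le_sum fun k _ => ?_
  unfold push
  rw [← sum_sub_distrib]
  exact abs_sum_le_sum_abs _ _

end DPI

/-! ## §5 Tensorisation (Kakutani mechanism) and the Bernoulli block [folklore: Ghosal–van der Vaart Cor. B.9, Lemma B.10] -/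

section Tensor
variable {ι' : Type*}

/-- **TENSORISATION** [folklore]: the affinity of product weights is the product of the affinities — the Hellinger defect `−log bc` is
ADDITIVE over independent blocks (whence `n_K` i.i.d.-like blocks with per-block defect `η_K` give total defect `n_K·η_K ≈ λ_K∕2`). -/
theorem bc_product (T : Finset ι) (T' : Finset ι') (p q : ι → ℝ) (p' q' : ι' → ℝ)
    (hp : ∀ τ ∈ T, 0 ≤ p τ) (hq : ∀ τ ∈ T, 0 ≤ q τ) :
    bc (T ×ˢ T') (fun x => p x.1 * p' x.2) (fun x => q x.1 * q' x.2) = bc T p q * bc T' p' q' := by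
  unfold bc
  rw [sum_product, sum_mul_sum]
  refine sum_congr rfl fun τ hτ => sum_congr rfl fun τ' _ => ?_
  rw [show p τ * p' τ' * (q τ * q' τ') = (p τ * q τ) * (p' τ' * q' τ') by ring,
    Real.sqrt_mul (mul_nonneg (hp τ hτ) (hq τ hτ))]

/-- the two-point (Bernoulli) weight `v ↦ if v then a else 1 − a`. -/
def ber (a : ℝ) : Bool → ℝ := fun v => if v then a else 1 - a

/-- one Bernoulli block: `bc = √(ab) + √((1−a)(1−b))`. [folklore] -/
theorem bc_ber (a b : ℝ) : bc Finset.univ (ber a) (ber b) = Real.sqrt (a * b) + Real.sqrt ((1 - a) * (1 - b)) := by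
  simp [bc, ber]

/-- its Hellinger form: `1 − (√(ab) + √((1−a)(1−b))) = ½[(√a−√b)² + (√(1−a)−√(1−b))²] = H²(Ber a, Ber b)`. [folklore] -/
theorem one_sub_bc_ber {a b : ℝ} (ha : 0 ≤ a) (ha1 : a ≤ 1) (hb : 0 ≤ b) (hb1 : b ≤ 1) :
    1 - (Real.sqrt (a * b) + Real.sqrt ((1 - a) * (1 - b)))
      = ((Real.sqrt a - Real.sqrt b) ^ 2 + (Real.sqrt (1 - a) - Real.sqrt (1 - b)) ^ 2) / 2 := by
  rw [Real.sqrt_mul ha, Real.sqrt_mul (sub_nonneg.2 ha1)]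
  have h1 := Real.sq_sqrt ha
  have h2 := Real.sq_sqrt hb
  have h3 := Real.sq_sqrt (sub_nonneg.2 ha1)
  have h4 := Real.sq_sqrt (sub_nonneg.2 hb1)
  linear_combination (-(1:ℝ)/2) * h1 + (-(1:ℝ)/2) * h2 + (-(1:ℝ)/2) * h3 + (-(1:ℝ)/2) * h4

/-- `n` independent Bernoulli blocks (product weights on `Fin n → Bool`): `bc = (√(ab) + √((1−a)(1−b)))^n`, i.e. the defect is
`n·(−log(√(ab)+√((1−a)(1−b))))` — the caricature's `λ_K`-reading (`n = n_K` young blocks, `a, b` = per-block large-field odds of the two runs). [folklore] -/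
theorem bc_pi_ber (n : ℕ) {a b : ℝ} (ha : 0 ≤ a) (ha1 : a ≤ 1) (hb : 0 ≤ b) (hb1 : b ≤ 1) :
    bc (Finset.univ : Finset (Fin n → Bool)) (fun v => ∏ i, ber a (v i)) (fun v => ∏ i, ber b (v i))
      = (Real.sqrt (a * b) + Real.sqrt ((1 - a) * (1 - b))) ^ n := by
  classical
  have hnn : ∀ (c : ℝ), 0 ≤ c → c ≤ 1 → ∀ w : Bool, 0 ≤ ber c w := fun c hc hc1 w => by
    unfold ber; split_ifs <;> linarith
  unfold bc
  calc ∑ v : Fin n → Bool, Real.sqrt ((∏ i, ber a (v i)) * ∏ i, ber b (v i))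
      = ∑ v : Fin n → Bool, ∏ i, Real.sqrt (ber a (v i) * ber b (v i)) := by
        refine sum_congr rfl fun v _ => ?_
        rw [← prod_mul_distrib, Real.sqrt_prod _ fun i _ => mul_nonneg (hnn a ha ha1 _) (hnn b hb hb1 _)]
    _ = ∏ _i : Fin n, ∑ w : Bool, Real.sqrt (ber a w * ber b w) := by
        rw [prod_univ_sum (fun _ : Fin n => (Finset.univ : Finset Bool)) (fun _ w => Real.sqrt (ber a w * ber b w)),
          Fintype.piFinset_univ]
    _ = (Real.sqrt (a * b) + Real.sqrt ((1 - a) * (1 - b))) ^ n := by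
        rw [prod_const, card_univ, Fintype.card_fin]
        congr 1
        simp [ber]

end Tensor

/-! ## §6 The free-energy reading: `bc` of the normalised laws `= exp(−Δ)`, `Δ = ½log Z_A + ½log Z_B − log Z(½)` [folklore] -/

/-- midpoint defect of the interpolated class free energy `s ↦ log Σ_τ A^{1−s} B^s` (`= −log` Hellinger affinity of the normalised laws). -/
def fdef (T : Finset ι) (A B : ι → ℝ) : ℝ :=
  (Real.log (∑ τ ∈ T, A τ) + Real.log (∑ τ ∈ T, B τ)) / 2 - Real.log (bc T A B)

theorem bc_normalised_eq (T : Finset ι) {A B : ι → ℝ}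
    (hZA : 0 < ∑ τ ∈ T, A τ) (hZB : 0 < ∑ τ ∈ T, B τ) :
    bc T (fun τ => A τ / ∑ σ ∈ T, A σ) (fun τ => B τ / ∑ σ ∈ T, B σ)
      = bc T A B / Real.sqrt ((∑ τ ∈ T, A τ) * (∑ τ ∈ T, B τ)) := by
  unfold bc
  rw [sum_div]
  refine sum_congr rfl fun τ hτ => ?_
  rw [div_mul_div_comm, Real.sqrt_div' _ (mul_nonneg hZA.le hZB.le)]

/-- **`bc(normalised) = e^{−Δ}`** [folklore] — the Hellinger affinity of the two runs' class laws IS the exponential of minus the midpoint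
log-convexity defect of the interpolated class free energy. -/
theorem bc_normalised_eq_exp_neg_fdef (T : Finset ι) {A B : ι → ℝ}
    (hZA : 0 < ∑ τ ∈ T, A τ) (hZB : 0 < ∑ τ ∈ T, B τ) (hov : 0 < bc T A B) :
    bc T (fun τ => A τ / ∑ σ ∈ T, A σ) (fun τ => B τ / ∑ σ ∈ T, B σ) = Real.exp (- fdef T A B) := by
  rw [bc_normalised_eq T hZA hZB, fdef, neg_sub, Real.exp_sub, Real.exp_log hov]
  congr 1
  rw [Real.sqrt_eq_rpow, Real.rpow_def_of_pos (mul_pos hZA hZB), Real.log_mul hZA.ne' hZB.ne']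
  congr 1
  ring

/-- `Δ ≥ 0` (log-convexity), for nonnegative weights with positive overlap. [folklore] -/
theorem fdef_nonneg (T : Finset ι) {A B : ι → ℝ} (hA : ∀ τ ∈ T, 0 ≤ A τ) (hB : ∀ τ ∈ T, 0 ≤ B τ)
    (hZA : 0 < ∑ τ ∈ T, A τ) (hZB : 0 < ∑ τ ∈ T, B τ) (hov : 0 < bc T A B) : 0 ≤ fdef T A B := by
  have hp : ∀ τ ∈ T, 0 ≤ A τ / ∑ σ ∈ T, A σ := fun τ hτ => div_nonneg (hA τ hτ) hZA.le
  have hq : ∀ τ ∈ T, 0 ≤ B τ / ∑ σ ∈ T, B σ := fun τ hτ => div_nonneg (hB τ hτ) hZB.le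
  have hp1 : ∑ τ ∈ T, A τ / ∑ σ ∈ T, A σ = 1 := by rw [← sum_div, div_self hZA.ne']
  have hq1 : ∑ τ ∈ T, B τ / ∑ σ ∈ T, B σ = 1 := by rw [← sum_div, div_self hZB.ne']
  have h := bc_le_one hp hq hp1 hq1
  rw [bc_normalised_eq_exp_neg_fdef T hZA hZB hov] at h
  have h2 := Real.add_one_le_exp (-fdef T A B)
  linarith


/-! ## §6b Class-level Gibbs–Bogoliubov: the target constant is sandwiched by the two runs' mean log-increments [folklore: two-sided
Jensen, Contucci–Giardinà (3.78) at CLASS level — not over the UV layer as in ROUTES-NE7 d19∕(a)] -/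

section Sandwich
variable {A B : ι → ℝ}

/-- JENSEN for `exp` [folklore]: for a law `p` on `T`, `exp(Σ p·h) ≤ Σ p·exp h`. -/
theorem exp_sum_mul_le (hp : ∀ τ ∈ T, 0 ≤ p τ) (hp1 : ∑ τ ∈ T, p τ = 1) (h : ι → ℝ) :
    Real.exp (∑ τ ∈ T, p τ * h τ) ≤ ∑ τ ∈ T, p τ * Real.exp (h τ) := by
  have := (convexOn_exp).map_sum_le (t := T) (w := p) (p := h) hp hp1 (fun _ _ => Set.mem_univ _)
  simpa [smul_eq_mul] using this

/-- lower Gibbs–Bogoliubov bound [folklore]: `⟨log B − log A⟩_A ≤ log ΣB − log ΣA` for positive weights. -/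
theorem mean_logRatio_le_log_sub_log (hA : ∀ τ ∈ T, 0 < A τ) (hB : ∀ τ ∈ T, 0 < B τ) (hZA : 0 < ∑ τ ∈ T, A τ) :
    (∑ τ ∈ T, A τ * (Real.log (B τ) - Real.log (A τ))) / ∑ τ ∈ T, A τ
      ≤ Real.log (∑ τ ∈ T, B τ) - Real.log (∑ τ ∈ T, A τ) := by
  set ZA := ∑ τ ∈ T, A τ with hZAdef
  have hp : ∀ τ ∈ T, 0 ≤ A τ / ZA := fun τ hτ => div_nonneg (hA τ hτ).le hZA.le
  have hp1 : ∑ τ ∈ T, A τ / ZA = 1 := by rw [← sum_div, div_self hZA.ne']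
  have hJ := exp_sum_mul_le hp hp1 (fun τ => Real.log (B τ) - Real.log (A τ))
  have hR : ∑ τ ∈ T, A τ / ZA * Real.exp (Real.log (B τ) - Real.log (A τ)) = (∑ τ ∈ T, B τ) / ZA := by
    rw [sum_div]
    refine sum_congr rfl fun τ hτ => ?_
    rw [Real.exp_sub, Real.exp_log (hB τ hτ), Real.exp_log (hA τ hτ)]
    field_simp [(hA τ hτ).ne']
  have hL : ∑ τ ∈ T, A τ / ZA * (Real.log (B τ) - Real.log (A τ)) = (∑ τ ∈ T, A τ * (Real.log (B τ) - Real.log (A τ))) / ZA := by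
    rw [sum_div]
    refine sum_congr rfl fun τ _ => ?_
    ring
  rw [hR, hL] at hJ
  have hZB : 0 < ∑ τ ∈ T, B τ := by
    have hne : T.Nonempty := by
      by_contra hT
      rw [Finset.not_nonempty_iff_eq_empty] at hT
      rw [hT, sum_empty] at hZAdef
      exact (lt_irrefl (0:ℝ)) (hZAdef ▸ hZA)
    exact sum_pos hB hne
  have h2 := Real.log_le_log (Real.exp_pos _) hJ
  rw [Real.log_exp, Real.log_div hZB.ne' hZA.ne'] at h2
  exact h2

/-- **CLASS-LEVEL GIBBS–BOGOLIUBOV SANDWICH** [folklore]: `⟨h⟩_A ≤ log ΣB − log ΣA ≤ ⟨h⟩_B`, `h = log B − log A` the two-run log-increment;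
the WIDTH `⟨h⟩_B − ⟨h⟩_A` equals `∫₀¹ Var_{μ_s}(h) ds` along the interpolated class ensemble `μ_s ∝ A^{1−s}B^s` (thermodynamic integration,
not re-derived here). -/
theorem gibbs_bogoliubov_sandwich (hA : ∀ τ ∈ T, 0 < A τ) (hB : ∀ τ ∈ T, 0 < B τ)
    (hZA : 0 < ∑ τ ∈ T, A τ) (hZB : 0 < ∑ τ ∈ T, B τ) :
    (∑ τ ∈ T, A τ * (Real.log (B τ) - Real.log (A τ))) / ∑ τ ∈ T, A τ
        ≤ Real.log (∑ τ ∈ T, B τ) - Real.log (∑ τ ∈ T, A τ) ∧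
      Real.log (∑ τ ∈ T, B τ) - Real.log (∑ τ ∈ T, A τ)
        ≤ (∑ τ ∈ T, B τ * (Real.log (B τ) - Real.log (A τ))) / ∑ τ ∈ T, B τ := by
  refine ⟨mean_logRatio_le_log_sub_log hA hB hZA, ?_⟩
  have h := mean_logRatio_le_log_sub_log hB hA hZB
  have e : ∑ τ ∈ T, B τ * (Real.log (A τ) - Real.log (B τ)) = - ∑ τ ∈ T, B τ * (Real.log (B τ) - Real.log (A τ)) := by
    rw [← sum_neg_distrib]
    exact sum_congr rfl fun τ _ => by ring
  rw [e, neg_div] at h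
  linarith

/-- **TARGET RADIUS ≤ RESPONSE + TWO WIDTHS** [folklore; pure order reasoning]: if `m(t) ≤ c(t) ≤ M(t)` on `|t| ≤ l₀`, the run-A mean responds
to the source by at most `r` (`|m(t) − m(0)| ≤ r`) and both widths are `≤ w`, then `c` is matched modulo the constant `c(0)` within `r + 2w` —
exactly the `∀ t, |t| ≤ l₀ → |log Z_{K+1}(t) − log Z_K(t) − c| ≤ vol·δ_K` shape of `T4CauchySum.MatchingModConstants` at one `K`. -/
theorem matching_of_response_and_width {l₀ r w : ℝ} {c m M : ℝ → ℝ} (hl₀ : 0 ≤ l₀)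
    (hlo : ∀ t, |t| ≤ l₀ → m t ≤ c t) (hhi : ∀ t, |t| ≤ l₀ → c t ≤ M t)
    (hresp : ∀ t, |t| ≤ l₀ → |m t - m 0| ≤ r) (hwidth : ∀ t, |t| ≤ l₀ → M t - m t ≤ w) :
    ∃ c₀ : ℝ, ∀ t, |t| ≤ l₀ → |c t - c₀| ≤ r + 2 * w := by
  refine ⟨c 0, fun t ht => ?_⟩
  have h0 : |(0:ℝ)| ≤ l₀ := by simpa using hl₀
  have := hresp t ht
  rw [abs_le] at this ⊢
  constructor <;> linarith [hlo t ht, hhi t ht, hlo 0 h0, hhi 0 h0, hwidth t ht, hwidth 0 h0]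

end Sandwich

/-! ## §7 Link to the tree: the hybrid binder list (ANY six dials) pays at most a summable HELLINGER budget at the key
(via dag-n20-w4 p607565 `N20HybridClassLawBudget` BY NAME) -/

section Link
variable {l₀ vol : ℝ} {T : ℕ → Finset ι} {A B shA shB : ℕ → ℝ → ι → ℝ} {Bad : ℕ → ℝ → Finset ι} {W Wsh δ : ℕ → ℝ}
variable [DecidableEq ι]

/-- `HybridNE7 …` ⇒ at every admissible source value with positive totals the two runs' normalised class laws satisfy
`‖p_K − q_K‖₁ ≤ 2·(2(W_K + Wsh_K) + 2|vol·δ_K|)`. [folklore; consumer dag-n20-w4 `abs_classLaw_sub_classLaw_le_of_hybridNE7`] -/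
theorem l1_classLaw_le_of_hybridNE7 (h : HybridNE7 l₀ vol T A B Bad W shA shB Wsh δ) (K : ℕ) {t : ℝ} (ht : |t| ≤ l₀)
    (hZA : 0 < ∑ τ ∈ T K, A K t τ) (hZB : 0 < ∑ τ ∈ T K, B K t τ) :
    l1 (T K) (fun τ => A K t τ / ∑ σ ∈ T K, A K t σ) (fun τ => B K t τ / ∑ σ ∈ T K, B K t σ)
      ≤ 2 * (2 * (W K + Wsh K) + 2 * |vol * δ K|) := by
  refine l1_le_two_mul_of_forall_subset (fun S hS => ?_) ?_
  · rw [← sum_div, ← sum_div]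
    exact (le_abs_self _).trans (abs_classLaw_sub_classLaw_le_of_hybridNE7 h K ht hZA hZB hS)
  · rw [← sum_div, ← sum_div, div_self hZA.ne', div_self hZB.ne']

/-- **HYBRID ⇒ HELLINGER BUDGET** [folklore]: `HybridNE7 …` (any dials) ⇒ `1 − bc_K(t) ≤ 2(W_K + Wsh_K) + 2|vol·δ_K|` for the normalised
class laws at every admissible `t` with positive totals and nonnegative class weights. -/
theorem one_sub_bc_classLaw_le_of_hybridNE7 (h : HybridNE7 l₀ vol T A B Bad W shA shB Wsh δ) (K : ℕ) {t : ℝ} (ht : |t| ≤ l₀)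
    (hA : ∀ τ ∈ T K, 0 ≤ A K t τ) (hB : ∀ τ ∈ T K, 0 ≤ B K t τ)
    (hZA : 0 < ∑ τ ∈ T K, A K t τ) (hZB : 0 < ∑ τ ∈ T K, B K t τ) :
    1 - bc (T K) (fun τ => A K t τ / ∑ σ ∈ T K, A K t σ) (fun τ => B K t τ / ∑ σ ∈ T K, B K t σ)
      ≤ 2 * (W K + Wsh K) + 2 * |vol * δ K| := by
  have hp : ∀ τ ∈ T K, 0 ≤ A K t τ / ∑ σ ∈ T K, A K t σ := fun τ hτ => div_nonneg (hA τ hτ) hZA.le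
  have hq : ∀ τ ∈ T K, 0 ≤ B K t τ / ∑ σ ∈ T K, B K t σ := fun τ hτ => div_nonneg (hB τ hτ) hZB.le
  have hp1 : ∑ τ ∈ T K, A K t τ / ∑ σ ∈ T K, A K t σ = 1 := by rw [← sum_div, div_self hZA.ne']
  have hq1 : ∑ τ ∈ T K, B K t τ / ∑ σ ∈ T K, B K t σ = 1 := by rw [← sum_div, div_self hZB.ne']
  have h1 := one_sub_bc_le_half_l1 hp hq hp1 hq1
  have h2 := l1_classLaw_le_of_hybridNE7 h K ht hZA hZB
  linarith

/-- **NECESSITY IN THE HELLINGER CURRENCY** [folklore]: along ANY admissible source selection `t_K` (positive totals, nonnegative weights),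
`HybridNE7 …` forces the Hellinger defects `1 − bc_K(t_K)` of the two runs' class laws to be SUMMABLE over `K` — for every choice of the six
dials.  Contrapositive = the disprover's handle of dag-n20-w4 ★★, restated: an unsummable Hellinger defect at the key kills `stub_expansion13H`'s
`∃`-block for every `jc, sh` pinned to that key. -/
theorem summable_one_sub_bc_of_hybridNE7 (h : HybridNE7 l₀ vol T A B Bad W shA shB Wsh δ) (tsel : ℕ → ℝ)
    (ht : ∀ K, |tsel K| ≤ l₀) (hA : ∀ K, ∀ τ ∈ T K, 0 ≤ A K (tsel K) τ) (hB : ∀ K, ∀ τ ∈ T K, 0 ≤ B K (tsel K) τ)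
    (hZA : ∀ K, 0 < ∑ τ ∈ T K, A K (tsel K) τ) (hZB : ∀ K, 0 < ∑ τ ∈ T K, B K (tsel K) τ) :
    Summable fun K => 1 - bc (T K) (fun τ => A K (tsel K) τ / ∑ σ ∈ T K, A K (tsel K) σ)
      (fun τ => B K (tsel K) τ / ∑ σ ∈ T K, B K (tsel K) σ) := by
  refine Summable.of_nonneg_of_le (fun K => ?_) (fun K => one_sub_bc_classLaw_le_of_hybridNE7 h K (ht K) (hA K) (hB K) (hZA K) (hZB K))
    (summable_budget_of_hybridNE7 h)
  have hp : ∀ τ ∈ T K, 0 ≤ A K (tsel K) τ / ∑ σ ∈ T K, A K (tsel K) σ := fun τ hτ => div_nonneg (hA K τ hτ) (hZA K).le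
  have hq : ∀ τ ∈ T K, 0 ≤ B K (tsel K) τ / ∑ σ ∈ T K, B K (tsel K) σ := fun τ hτ => div_nonneg (hB K τ hτ) (hZB K).le
  have hp1 : ∑ τ ∈ T K, A K (tsel K) τ / ∑ σ ∈ T K, A K (tsel K) σ = 1 := by rw [← sum_div, div_self (hZA K).ne']
  have hq1 : ∑ τ ∈ T K, B K (tsel K) τ / ∑ σ ∈ T K, B K (tsel K) σ = 1 := by rw [← sum_div, div_self (hZB K).ne']
  exact sub_nonneg.2 (bc_le_one hp hq hp1 hq1)

/-- … and the unsummable contrapositive with EVERY dial free (cf. `N20HybridClassLawBudget.not_exists_hybridNE7_of_unsummable_classLawGap`). -/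
theorem not_exists_hybridNE7_of_unsummable_hellinger (tsel : ℕ → ℝ) (ht : ∀ K, |tsel K| ≤ l₀)
    (hA : ∀ K, ∀ τ ∈ T K, 0 ≤ A K (tsel K) τ) (hB : ∀ K, ∀ τ ∈ T K, 0 ≤ B K (tsel K) τ)
    (hZA : ∀ K, 0 < ∑ τ ∈ T K, A K (tsel K) τ) (hZB : ∀ K, 0 < ∑ τ ∈ T K, B K (tsel K) τ)
    (hH : ¬ Summable fun K => 1 - bc (T K) (fun τ => A K (tsel K) τ / ∑ σ ∈ T K, A K (tsel K) σ)
      (fun τ => B K (tsel K) τ / ∑ σ ∈ T K, B K (tsel K) σ)) :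
    ¬ ∃ (Bad : ℕ → ℝ → Finset ι) (W : ℕ → ℝ) (shA shB : ℕ → ℝ → ι → ℝ) (Wsh δ : ℕ → ℝ),
      HybridNE7 l₀ vol T A B Bad W shA shB Wsh δ := by
  rintro ⟨Bad, W, shA, shB, Wsh, δ, h⟩
  exact hH (summable_one_sub_bc_of_hybridNE7 h tsel ht hA hB hZA hZB)

/-- **SUFFICIENCY IN THE HELLINGER CURRENCY, up to one application of dag-n20-w4's road** [folklore]: a Hellinger-type radius
`√(1 − bc_K(t)²) ≤ ρ_K` for the two runs' normalised class laws gives EXACTLY the per-set total-variation hypothesis of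
`N20HybridClassLawCharacterisation.exists_hybridNE7_of_target_of_classLawTV` (Le Cam: `|p(S) − q(S)| ≤ ½‖p−q‖₁ ≤ √(1 − bc²)`); with node U5's
`Target`, `Σ ρ_K < ∞` and `ρ_K < 1` that road then yields `∃ shA shB, HybridNE7 l₀ vol T A B (fun _ _ => ∅) (fun _ => 0) shA shB ρ δ`. -/
theorem classLawTV_of_hellinger {ρ : ℕ → ℝ}
    (hA : ∀ (K : ℕ) (t : ℝ), |t| ≤ l₀ → ∀ τ ∈ T K, 0 ≤ A K t τ) (hB : ∀ (K : ℕ) (t : ℝ), |t| ≤ l₀ → ∀ τ ∈ T K, 0 ≤ B K t τ)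
    (hZA : ∀ (K : ℕ) (t : ℝ), |t| ≤ l₀ → 0 < ∑ τ ∈ T K, A K t τ) (hZB : ∀ (K : ℕ) (t : ℝ), |t| ≤ l₀ → 0 < ∑ τ ∈ T K, B K t τ)
    (hH : ∀ (K : ℕ) (t : ℝ), |t| ≤ l₀ →
      Real.sqrt (1 - bc (T K) (fun τ => A K t τ / ∑ σ ∈ T K, A K t σ) (fun τ => B K t τ / ∑ σ ∈ T K, B K t σ) ^ 2) ≤ ρ K) :
    ∀ (K : ℕ) (t : ℝ), |t| ≤ l₀ → ∀ S ⊆ T K,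
      |(∑ τ ∈ S, A K t τ) / (∑ τ ∈ T K, A K t τ) - (∑ τ ∈ S, B K t τ) / (∑ τ ∈ T K, B K t τ)| ≤ ρ K := by
  intro K t ht S hS
  have hp : ∀ τ ∈ T K, 0 ≤ A K t τ / ∑ σ ∈ T K, A K t σ := fun τ hτ => div_nonneg (hA K t ht τ hτ) (hZA K t ht).le
  have hq : ∀ τ ∈ T K, 0 ≤ B K t τ / ∑ σ ∈ T K, B K t σ := fun τ hτ => div_nonneg (hB K t ht τ hτ) (hZB K t ht).le
  have hp1 : ∑ τ ∈ T K, A K t τ / ∑ σ ∈ T K, A K t σ = 1 := by rw [← sum_div, div_self (hZA K t ht).ne']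
  have hq1 : ∑ τ ∈ T K, B K t τ / ∑ σ ∈ T K, B K t σ = 1 := by rw [← sum_div, div_self (hZB K t ht).ne']
  have h1 := abs_setDiff_le_half_l1 (hp1.trans hq1.symm) hS
  have h2 := l1_le_two_sqrt_one_sub_bc_sq hp hq hp1 hq1
  rw [← sum_div, ← sum_div] at h1
  linarith [hH K t ht]

end Link

/-! ## §8 The window threshold doubles in the `L`-exponent under the L² road [arithmetic] -/

/-- With `ℓθ = log(1∕θ) > 0` and `ℓL = log L > 0`: the L²∕Hellinger critical window fraction `ℓθ∕(ℓθ + 2ℓL)` strictly exceeds the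
sup-road fraction `ℓθ∕(ℓθ + 4ℓL)` of `N20WindowKeyBudget.rpow_mul_lt_one_iff_lt_criticalRatio`. [arithmetic] -/
theorem criticalRatio_two_gt_four {ℓθ ℓL : ℝ} (hθ : 0 < ℓθ) (hL : 0 < ℓL) :
    ℓθ / (ℓθ + 4 * ℓL) < ℓθ / (ℓθ + 2 * ℓL) :=
  div_lt_div_of_pos_left hθ (by linarith) (by linarith)

/-! ## §10 ENDPOINT ROAD (edition 2): every load-bearing letter is a statement about the two ONE-RUN class laws [folklore]

CRIT-1's triage of edition 1 (`Cruxes/SpineGivenEndpointR13SepCoPH/CRIT-1-TRIAGE-hellinger-free-energy-road.md` §5) prices the interpolated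
class ensemble `μ_s ∝ A^{1−s}B^s` of §6b as a TWO-RUN object.  This section takes it off the load-bearing path.
* V-side: `one_sub_bc_le_wild_add_moment` — `1 − bc ≤ ½(p(W)+q(W)) + ⅛·Σ_{T∖W}(p+q)(log p − log q)²`, via the Padé bound
  `2(s−1)∕(s+1) ≤ log s` (no `tanh`, no range constant); for class weights `log p − log q = −(h − c)` with `h = log B − log A` the
  two-run increment and `c = log Z_B − log Z_A` the target constant (`one_sub_bc_classLaw_le_wild_add_moment`): the "variance" supply of K1 is
  the SECOND MOMENT OF THE CENTRED INCREMENT UNDER THE MIXTURE `½(p+q)` OF THE TWO ONE-RUN CLASS LAWS — no `μ_s`.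
* Target-side: the ENDPOINT RESPONSE IDENTITY `d∕dt[log Z_B − log Z_A] = Z_B'∕Z_B − Z_A'∕Z_A = E_q[∂h] + (E_q − E_p)[j]`, `j = A'∕A` the
  run-A class-level source current (`hasDerivAt_log_sum_sub_log_sum`, `response_split`); the COUPLING LEMMA
  `|(E_q − E_p) f| ≤ 2√(2(1−bc))·√(Σ ½(p+q)(f−c)²)` (`abs_sum_sub_sum_le_hellinger`) closes the cross term by the V-side functional itself
  (`abs_response_le`); and the mean-value step to the `MatchingModConstants` shape at one `K` (`matching_of_derivative_bound`).
So K1 = `Σ_K sup_t √(1−bc_K(t)) < ∞` is fed by ONE-run wild masses + a mixture second moment, and K2 by ONE-run-law expectations of the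
observables `∂h` (two-run observable, first moment only) and `j` (one-run observable, second moment): the interpolated ensemble survives only
inside the DEFINITION `Δ = −log bc` (§6) and the optional tame-only sharpening `Δ ≤ ⅛ sup_s Var_{μ_s}(h)` (not used, not checked). -/

section Endpoint

/-- Cauchy–Schwarz with absolute value [folklore]: `|Σ a·b| ≤ √(Σa²)·√(Σb²)`. -/
theorem abs_sum_mul_le_sqrt_mul_sqrt (T : Finset ι) (a b : ι → ℝ) :
    |∑ τ ∈ T, a τ * b τ| ≤ Real.sqrt (∑ τ ∈ T, a τ ^ 2) * Real.sqrt (∑ τ ∈ T, b τ ^ 2) := by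
  rw [← Real.sqrt_mul (sum_nonneg fun _ _ => sq_nonneg _)]
  exact Real.abs_le_sqrt (sum_mul_sq_le_sq_mul_sq T a b)

/-- The `[1,1]`-Padé lower bound for the logarithm [folklore]: `2(s − 1)∕(s + 1) ≤ log s` for `s ≥ 1` — the `k = 0` term of Mathlib's series
`log(1+x) − log(1−x) = Σ_k 2x^{2k+1}∕(2k+1)` at `x = (s−1)∕(s+1) ∈ [0,1)`. -/
theorem two_mul_sub_div_add_le_log {s : ℝ} (hs : 1 ≤ s) : 2 * (s - 1) / (s + 1) ≤ Real.log s := by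
  have hs0 : 0 < s + 1 := by linarith
  have hne : s + 1 ≠ 0 := hs0.ne'
  set x := (s - 1) / (s + 1) with hx
  have hx0 : 0 ≤ x := div_nonneg (by linarith) hs0.le
  have hx1 : x < 1 := by rw [hx, div_lt_one hs0]; linarith
  have habs : |x| < 1 := by rw [abs_of_nonneg hx0]; exact hx1
  have hS := Real.hasSum_log_sub_log_of_abs_lt_one habs
  have h0 : (2:ℝ) * (1 / (2 * ((0:ℕ):ℝ) + 1)) * x ^ (2 * 0 + 1) ≤ Real.log (1 + x) - Real.log (1 - x) :=
    le_hasSum hS 0 (fun j _ => by positivity)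
  norm_num at h0
  have e1 : 1 + x = 2 * s / (s + 1) := by rw [hx]; field_simp; ring
  have e2 : 1 - x = 2 / (s + 1) := by rw [hx]; field_simp; ring
  have e3 : Real.log (1 + x) - Real.log (1 - x) = Real.log s := by
    have h1 : (1 + x) ≠ 0 := by rw [e1]; positivity
    have h2 : (1 - x) ≠ 0 := by rw [e2]; positivity
    rw [← Real.log_div h1 h2, e1, e2]
    congr 1
    field_simp
  rw [e3] at h0
  calc 2 * (s - 1) / (s + 1) = 2 * x := by rw [hx]; ring
    _ ≤ Real.log s := h0

/-- [folklore] `(a − b)∕(a + b) ≤ (log a − log b)∕2` for `a ≥ b > 0` (i.e. `tanh(u∕2) ≤ u∕2`, `u = log(a∕b) ≥ 0`). -/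
theorem sub_div_add_le_half_log {a b : ℝ} (ha : 0 < a) (hb : 0 < b) (hab : b ≤ a) :
    (a - b) / (a + b) ≤ (Real.log a - Real.log b) / 2 := by
  have hs : 1 ≤ a / b := by rwa [le_div_iff₀ hb, one_mul]
  have h := two_mul_sub_div_add_le_log hs
  rw [← Real.log_div ha.ne' hb.ne']
  have e : 2 * (a / b - 1) / (a / b + 1) = 2 * ((a - b) / (a + b)) := by
    field_simp
  rw [e] at h
  linarith

/-- RANGE-FREE SECOND-ORDER TERM [folklore]: for `a, b > 0`, `(a − b)²∕(a + b) ≤ (a + b)·(log a − log b)²∕4`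
(the `tanh² ≤ id²` sharpening of `sub_sq_div_add_eq_mul_tanh_sq`; universal constant, no range `R`). -/
theorem sub_sq_div_add_le_mul_log_sq {a b : ℝ} (ha : 0 < a) (hb : 0 < b) :
    (a - b) ^ 2 / (a + b) ≤ (a + b) * (Real.log a - Real.log b) ^ 2 / 4 := by
  have hab : 0 < a + b := add_pos ha hb
  have key : |a - b| / (a + b) ≤ |Real.log a - Real.log b| / 2 := by
    rcases le_total b a with h | h
    · rw [abs_of_nonneg (by linarith), abs_of_nonneg (by linarith [Real.log_le_log hb h])]
      exact sub_div_add_le_half_log ha hb h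
    · rw [abs_of_nonpos (by linarith), abs_of_nonpos (by linarith [Real.log_le_log ha h]), neg_sub, neg_sub, add_comm]
      exact sub_div_add_le_half_log hb ha h
  have k2 : (|a - b| / (a + b)) ^ 2 ≤ (|Real.log a - Real.log b| / 2) ^ 2 :=
    pow_le_pow_left₀ (div_nonneg (abs_nonneg _) hab.le) key 2
  rw [div_pow, div_pow, sq_abs, sq_abs, div_le_iff₀ (pow_pos hab 2)] at k2
  rw [div_le_iff₀ hab]
  calc (a - b) ^ 2 ≤ (Real.log a - Real.log b) ^ 2 / 2 ^ 2 * (a + b) ^ 2 := k2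
    _ = (a + b) * (Real.log a - Real.log b) ^ 2 / 4 * (a + b) := by ring

/-- **WILD MASS + MIXTURE SECOND MOMENT** [folklore]: for laws `p, q` on `T`, positive off a "wild" set `W ⊆ T`,
`1 − bc ≤ ½(p(W) + q(W)) + ⅛·Σ_{T∖W} (p + q)(log p − log q)²` — wild classes cost their mass, tame classes cost the second moment of the
log-ratio under the MIXTURE `½(p+q)` of the two laws (times `¼`).  No interpolated ensemble, no range constant. -/
theorem one_sub_bc_le_wild_add_moment [DecidableEq ι] (hp : ∀ τ ∈ T, 0 ≤ p τ) (hq : ∀ τ ∈ T, 0 ≤ q τ)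
    (hp1 : ∑ τ ∈ T, p τ = 1) (hq1 : ∑ τ ∈ T, q τ = 1) {W : Finset ι} (hW : W ⊆ T)
    (hp' : ∀ τ ∈ T \ W, 0 < p τ) (hq' : ∀ τ ∈ T \ W, 0 < q τ) :
    1 - bc T p q ≤ (∑ τ ∈ W, (p τ + q τ)) / 2
      + (∑ τ ∈ T \ W, (p τ + q τ) * (Real.log (p τ) - Real.log (q τ)) ^ 2) / 8 := by
  have h := one_sub_bc_le_wild_add_tame hp hq hp1 hq1 hW
  have h2 : ∑ τ ∈ T \ W, (p τ - q τ) ^ 2 / (p τ + q τ)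
      ≤ ∑ τ ∈ T \ W, (p τ + q τ) * (Real.log (p τ) - Real.log (q τ)) ^ 2 / 4 :=
    sum_le_sum fun τ hτ => sub_sq_div_add_le_mul_log_sq (hp' τ hτ) (hq' τ hτ)
  rw [← sum_div] at h2
  linarith

/-- The same for CLASS WEIGHTS `A, B > 0` [folklore]: with `p = A∕Z_A`, `q = B∕Z_B` the two ONE-RUN class laws, `h = log B − log A` the
two-run log-increment and `c = log Z_B − log Z_A` the target constant one has `log p − log q = −(h − c)`, hence
`1 − bc(p,q) ≤ ½(p(W)+q(W)) + ⅛·Σ_{T∖W}(p+q)·(h − c)²`: the V-supply of the card's K1 is a SECOND MOMENT OF THE CENTRED INCREMENT UNDER THE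
MIXTURE OF THE TWO ONE-RUN CLASS LAWS (answer to CRIT-1 §5: no `μ_s` on the load-bearing path). -/
theorem one_sub_bc_classLaw_le_wild_add_moment [DecidableEq ι] {A B : ι → ℝ}
    (hA : ∀ τ ∈ T, 0 < A τ) (hB : ∀ τ ∈ T, 0 < B τ) (hZA : 0 < ∑ τ ∈ T, A τ) (hZB : 0 < ∑ τ ∈ T, B τ)
    {W : Finset ι} (hW : W ⊆ T) :
    1 - bc T (fun τ => A τ / ∑ σ ∈ T, A σ) (fun τ => B τ / ∑ σ ∈ T, B σ)
      ≤ (∑ τ ∈ W, (A τ / (∑ σ ∈ T, A σ) + B τ / (∑ σ ∈ T, B σ))) / 2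
        + (∑ τ ∈ T \ W, (A τ / (∑ σ ∈ T, A σ) + B τ / (∑ σ ∈ T, B σ))
            * ((Real.log (B τ) - Real.log (A τ)) - (Real.log (∑ σ ∈ T, B σ) - Real.log (∑ σ ∈ T, A σ))) ^ 2) / 8 := by
  set ZA := ∑ σ ∈ T, A σ with hZAdef
  set ZB := ∑ σ ∈ T, B σ with hZBdef
  have hp : ∀ τ ∈ T, 0 ≤ A τ / ZA := fun τ hτ => div_nonneg (hA τ hτ).le hZA.le
  have hq : ∀ τ ∈ T, 0 ≤ B τ / ZB := fun τ hτ => div_nonneg (hB τ hτ).le hZB.le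
  have hp1 : ∑ τ ∈ T, A τ / ZA = 1 := by rw [← sum_div, div_self hZA.ne']
  have hq1 : ∑ τ ∈ T, B τ / ZB = 1 := by rw [← sum_div, div_self hZB.ne']
  have hp' : ∀ τ ∈ T \ W, 0 < A τ / ZA := fun τ hτ => div_pos (hA τ (sdiff_subset hτ)) hZA
  have hq' : ∀ τ ∈ T \ W, 0 < B τ / ZB := fun τ hτ => div_pos (hB τ (sdiff_subset hτ)) hZB
  have h := one_sub_bc_le_wild_add_moment hp hq hp1 hq1 hW hp' hq'
  have e2 : ∑ τ ∈ T \ W, (A τ / ZA + B τ / ZB) * (Real.log (A τ / ZA) - Real.log (B τ / ZB)) ^ 2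
      = ∑ τ ∈ T \ W, (A τ / ZA + B τ / ZB) * ((Real.log (B τ) - Real.log (A τ)) - (Real.log ZB - Real.log ZA)) ^ 2 := by
    refine sum_congr rfl fun τ hτ => ?_
    have hτT : τ ∈ T := sdiff_subset hτ
    rw [Real.log_div (hA τ hτT).ne' hZA.ne', Real.log_div (hB τ hτT).ne' hZB.ne']
    ring
  rw [e2] at h
  exact h

/-- **COUPLING LEMMA** [folklore; the Hellinger testing inequality]: for laws `p, q` on `T`, any observable `f` and any centring constant `c`,
`|E_q f − E_p f| ≤ 2·√(2(1 − bc(p,q)))·√(Σ ½(p+q)(f − c)²)` — the difference of the two ONE-RUN expectations of a (one- or two-run)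
observable costs the HELLINGER functional times the observable's mixture second moment.  Bounds the cross term `(E_q − E_p)[j]` below. -/
theorem abs_sum_sub_sum_le_hellinger (hp : ∀ τ ∈ T, 0 ≤ p τ) (hq : ∀ τ ∈ T, 0 ≤ q τ)
    (hp1 : ∑ τ ∈ T, p τ = 1) (hq1 : ∑ τ ∈ T, q τ = 1) (f : ι → ℝ) (c : ℝ) :
    |∑ τ ∈ T, q τ * f τ - ∑ τ ∈ T, p τ * f τ|
      ≤ 2 * Real.sqrt (2 * (1 - bc T p q)) * Real.sqrt (∑ τ ∈ T, (p τ + q τ) / 2 * (f τ - c) ^ 2) := by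
  have e0 : ∑ τ ∈ T, p τ * f τ - ∑ τ ∈ T, q τ * f τ
      = ∑ τ ∈ T, (Real.sqrt (p τ) - Real.sqrt (q τ)) * ((Real.sqrt (p τ) + Real.sqrt (q τ)) * (f τ - c)) := by
    have hc : ∑ τ ∈ T, (p τ - q τ) * c = 0 := by
      rw [← sum_mul, sum_sub_distrib, hp1, hq1, sub_self, zero_mul]
    calc ∑ τ ∈ T, p τ * f τ - ∑ τ ∈ T, q τ * f τ
        = ∑ τ ∈ T, (p τ - q τ) * (f τ - c) + ∑ τ ∈ T, (p τ - q τ) * c := by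
          rw [← sum_sub_distrib, ← sum_add_distrib]
          exact sum_congr rfl fun τ _ => by ring
      _ = ∑ τ ∈ T, (p τ - q τ) * (f τ - c) := by rw [hc, add_zero]
      _ = ∑ τ ∈ T, (Real.sqrt (p τ) - Real.sqrt (q τ)) * ((Real.sqrt (p τ) + Real.sqrt (q τ)) * (f τ - c)) := by
          refine sum_congr rfl fun τ hτ => ?_
          have hp2 := Real.sq_sqrt (hp τ hτ)
          have hq2 := Real.sq_sqrt (hq τ hτ)
          have hfac : p τ - q τ = (Real.sqrt (p τ) - Real.sqrt (q τ)) * (Real.sqrt (p τ) + Real.sqrt (q τ)) := by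
            linear_combination (-1 : ℝ) * hp2 + hq2
          rw [hfac]; ring
  have h1 : |∑ τ ∈ T, (Real.sqrt (p τ) - Real.sqrt (q τ)) * ((Real.sqrt (p τ) + Real.sqrt (q τ)) * (f τ - c))|
      ≤ Real.sqrt (∑ τ ∈ T, (Real.sqrt (p τ) - Real.sqrt (q τ)) ^ 2)
        * Real.sqrt (∑ τ ∈ T, ((Real.sqrt (p τ) + Real.sqrt (q τ)) * (f τ - c)) ^ 2) :=
    abs_sum_mul_le_sqrt_mul_sqrt T (fun τ => Real.sqrt (p τ) - Real.sqrt (q τ))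
      (fun τ => (Real.sqrt (p τ) + Real.sqrt (q τ)) * (f τ - c))
  have e1 : ∑ τ ∈ T, (Real.sqrt (p τ) - Real.sqrt (q τ)) ^ 2 = 2 * (1 - bc T p q) := by
    rw [sum_sq_sqrt_sub hp hq, hp1, hq1]; ring
  have h3 : ∑ τ ∈ T, ((Real.sqrt (p τ) + Real.sqrt (q τ)) * (f τ - c)) ^ 2
      ≤ 2 ^ 2 * ∑ τ ∈ T, (p τ + q τ) / 2 * (f τ - c) ^ 2 := by
    rw [mul_sum]
    refine sum_le_sum fun τ hτ => ?_
    have hsq : (Real.sqrt (p τ) + Real.sqrt (q τ)) ^ 2 ≤ 2 * (p τ + q τ) := by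
      nlinarith [Real.sq_sqrt (hp τ hτ), Real.sq_sqrt (hq τ hτ), sq_nonneg (Real.sqrt (p τ) - Real.sqrt (q τ))]
    rw [mul_pow]
    nlinarith [sq_nonneg (f τ - c)]
  have h4 : Real.sqrt (∑ τ ∈ T, ((Real.sqrt (p τ) + Real.sqrt (q τ)) * (f τ - c)) ^ 2)
      ≤ 2 * Real.sqrt (∑ τ ∈ T, (p τ + q τ) / 2 * (f τ - c) ^ 2) := by
    calc Real.sqrt (∑ τ ∈ T, ((Real.sqrt (p τ) + Real.sqrt (q τ)) * (f τ - c)) ^ 2)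
        ≤ Real.sqrt (2 ^ 2 * ∑ τ ∈ T, (p τ + q τ) / 2 * (f τ - c) ^ 2) := Real.sqrt_le_sqrt h3
      _ = 2 * Real.sqrt (∑ τ ∈ T, (p τ + q τ) / 2 * (f τ - c) ^ 2) := by
          rw [Real.sqrt_mul (by norm_num), Real.sqrt_sq (by norm_num)]
  rw [abs_sub_comm, e0]
  rw [e1] at h1
  calc |∑ τ ∈ T, (Real.sqrt (p τ) - Real.sqrt (q τ)) * ((Real.sqrt (p τ) + Real.sqrt (q τ)) * (f τ - c))|
      ≤ Real.sqrt (2 * (1 - bc T p q))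
          * Real.sqrt (∑ τ ∈ T, ((Real.sqrt (p τ) + Real.sqrt (q τ)) * (f τ - c)) ^ 2) := h1
    _ ≤ Real.sqrt (2 * (1 - bc T p q)) * (2 * Real.sqrt (∑ τ ∈ T, (p τ + q τ) / 2 * (f τ - c) ^ 2)) :=
        mul_le_mul_of_nonneg_left h4 (Real.sqrt_nonneg _)
    _ = 2 * Real.sqrt (2 * (1 - bc T p q)) * Real.sqrt (∑ τ ∈ T, (p τ + q τ) / 2 * (f τ - c) ^ 2) := by ring

/-- Bias–variance [folklore]: for a law `p`, `Σ p(h − c)² = Σ p(h − E_p h)² + (E_p h − c)²`. -/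
theorem sum_mul_sq_sub_eq (hp1 : ∑ τ ∈ T, p τ = 1) (h : ι → ℝ) (c : ℝ) :
    ∑ τ ∈ T, p τ * (h τ - c) ^ 2
      = ∑ τ ∈ T, p τ * (h τ - ∑ σ ∈ T, p σ * h σ) ^ 2 + (∑ σ ∈ T, p σ * h σ - c) ^ 2 := by
  set m := ∑ σ ∈ T, p σ * h σ with hm
  have e : ∀ τ, p τ * (h τ - c) ^ 2
      = p τ * (h τ - m) ^ 2 + 2 * (m - c) * (p τ * h τ) + ((m - c) ^ 2 - 2 * (m - c) * m) * p τ := by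
    intro τ; ring
  rw [sum_congr rfl fun τ _ => e τ, sum_add_distrib, sum_add_distrib, ← mul_sum, ← mul_sum, hp1, ← hm]
  ring

/-- **MOMENT BOOTSTRAP** [folklore]: for laws `p, q`, an observable `h` and a centring `c` BETWEEN THE TWO MEANS (`E_p h ≤ c ≤ E_q h` — for
`h = log B − log A`, `c = log Z_B − log Z_A` this is §6b `gibbs_bogoliubov_sandwich`), the mixture second moment `M = Σ ½(p+q)(h − c)²` obeys
`M ≤ ½(Var_p h + Var_q h) + 4(1 − bc)·M` (joint bias bound `(E_p h − c)² + (E_q h − c)² ≤ (E_q h − E_p h)²`, and the width is a coupling term: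
`abs_sum_sub_sum_le_hellinger`; EDITION 3: constant halved `8 ↦ 4` per CRIT-1 g5 ed.2 sheet §2(c)). -/
theorem mixture_moment_le (hp : ∀ τ ∈ T, 0 ≤ p τ) (hq : ∀ τ ∈ T, 0 ≤ q τ)
    (hp1 : ∑ τ ∈ T, p τ = 1) (hq1 : ∑ τ ∈ T, q τ = 1) (h : ι → ℝ) {c : ℝ}
    (hlo : ∑ τ ∈ T, p τ * h τ ≤ c) (hhi : c ≤ ∑ τ ∈ T, q τ * h τ) :
    ∑ τ ∈ T, (p τ + q τ) / 2 * (h τ - c) ^ 2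
      ≤ ((∑ τ ∈ T, p τ * (h τ - ∑ σ ∈ T, p σ * h σ) ^ 2) + ∑ τ ∈ T, q τ * (h τ - ∑ σ ∈ T, q σ * h σ) ^ 2) / 2
        + 4 * (1 - bc T p q) * ∑ τ ∈ T, (p τ + q τ) / 2 * (h τ - c) ^ 2 := by
  have hsplit : ∑ τ ∈ T, (p τ + q τ) / 2 * (h τ - c) ^ 2
      = (∑ τ ∈ T, p τ * (h τ - c) ^ 2 + ∑ τ ∈ T, q τ * (h τ - c) ^ 2) / 2 := by
    rw [← sum_add_distrib, sum_div]
    exact sum_congr rfl fun τ _ => by ring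
  have ep := sum_mul_sq_sub_eq hp1 h c
  have eq' := sum_mul_sq_sub_eq hq1 h c
  have hW := abs_sum_sub_sum_le_hellinger hp hq hp1 hq1 h c
  have hbc : 0 ≤ 1 - bc T p q := by linarith [bc_le_one hp hq hp1 hq1]
  have hMnn : 0 ≤ ∑ τ ∈ T, (p τ + q τ) / 2 * (h τ - c) ^ 2 :=
    sum_nonneg fun τ hτ => mul_nonneg (div_nonneg (add_nonneg (hp τ hτ) (hq τ hτ)) (by norm_num)) (sq_nonneg _)
  have hW2 : (∑ τ ∈ T, q τ * h τ - ∑ τ ∈ T, p τ * h τ) ^ 2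
      ≤ 8 * (1 - bc T p q) * ∑ τ ∈ T, (p τ + q τ) / 2 * (h τ - c) ^ 2 := by
    calc (∑ τ ∈ T, q τ * h τ - ∑ τ ∈ T, p τ * h τ) ^ 2
        = |∑ τ ∈ T, q τ * h τ - ∑ τ ∈ T, p τ * h τ| ^ 2 := (sq_abs _).symm
      _ ≤ (2 * Real.sqrt (2 * (1 - bc T p q)) * Real.sqrt (∑ τ ∈ T, (p τ + q τ) / 2 * (h τ - c) ^ 2)) ^ 2 :=
          pow_le_pow_left₀ (abs_nonneg _) hW 2
      _ = 8 * (1 - bc T p q) * ∑ τ ∈ T, (p τ + q τ) / 2 * (h τ - c) ^ 2 := by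
          rw [mul_pow, mul_pow, Real.sq_sqrt (by linarith), Real.sq_sqrt hMnn]; ring
  -- joint bias bound: for `m_p ≤ c ≤ m_q`, `(m_p − c)² + (m_q − c)² ≤ (m_q − m_p)²` (cross term `2(c − m_p)(m_q − c) ≥ 0`).
  have b12 : (∑ σ ∈ T, p σ * h σ - c) ^ 2 + (∑ σ ∈ T, q σ * h σ - c) ^ 2
      ≤ (∑ τ ∈ T, q τ * h τ - ∑ τ ∈ T, p τ * h τ) ^ 2 := by
    nlinarith [mul_nonneg (sub_nonneg.mpr hlo) (sub_nonneg.mpr hhi)]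
  conv_lhs => rw [hsplit, ep, eq']
  linarith

/-- … hence in the PERTURBATIVE REGIME `1 − bc ≤ 1∕16` the mixture second moment is at most the SUM OF THE TWO ONE-RUN VARIANCES of `h`
[folklore] — closing the V-side on one-run-law statistics of the two-run observable `h` (plus wild masses, `one_sub_bc_le_wild_add_moment`). -/
theorem mixture_moment_le_of_regime (hp : ∀ τ ∈ T, 0 ≤ p τ) (hq : ∀ τ ∈ T, 0 ≤ q τ)
    (hp1 : ∑ τ ∈ T, p τ = 1) (hq1 : ∑ τ ∈ T, q τ = 1) (h : ι → ℝ) {c : ℝ}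
    (hlo : ∑ τ ∈ T, p τ * h τ ≤ c) (hhi : c ≤ ∑ τ ∈ T, q τ * h τ) (hreg : 1 - bc T p q ≤ 1 / 16) :
    ∑ τ ∈ T, (p τ + q τ) / 2 * (h τ - c) ^ 2
      ≤ (∑ τ ∈ T, p τ * (h τ - ∑ σ ∈ T, p σ * h σ) ^ 2) + ∑ τ ∈ T, q τ * (h τ - ∑ σ ∈ T, q σ * h σ) ^ 2 := by
  have hM := mixture_moment_le hp hq hp1 hq1 h hlo hhi
  have hMnn : 0 ≤ ∑ τ ∈ T, (p τ + q τ) / 2 * (h τ - c) ^ 2 :=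
    sum_nonneg fun τ hτ => mul_nonneg (div_nonneg (add_nonneg (hp τ hτ) (hq τ hτ)) (by norm_num)) (sq_nonneg _)
  nlinarith [mul_le_mul_of_nonneg_right hreg hMnn]

/-- **ENDPOINT RESPONSE, derivative form** [folklore calculus]: if every class weight of both runs is differentiable in the source parameter
at `t`, the target function `c(t) = log Z_B(t) − log Z_A(t)` has derivative `Z_B'∕Z_B − Z_A'∕Z_A` there. -/
theorem hasDerivAt_log_sum_sub_log_sum {A B : ℝ → ι → ℝ} {A' B' : ι → ℝ} {t : ℝ}
    (hA : ∀ τ ∈ T, HasDerivAt (fun s => A s τ) (A' τ) t) (hB : ∀ τ ∈ T, HasDerivAt (fun s => B s τ) (B' τ) t)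
    (hZA : ∑ τ ∈ T, A t τ ≠ 0) (hZB : ∑ τ ∈ T, B t τ ≠ 0) :
    HasDerivAt (fun s => Real.log (∑ τ ∈ T, B s τ) - Real.log (∑ τ ∈ T, A s τ))
      ((∑ τ ∈ T, B' τ) / (∑ τ ∈ T, B t τ) - (∑ τ ∈ T, A' τ) / (∑ τ ∈ T, A t τ)) t := by
  have hSA : HasDerivAt (fun s => ∑ τ ∈ T, A s τ) (∑ τ ∈ T, A' τ) t := HasDerivAt.fun_sum hA
  have hSB : HasDerivAt (fun s => ∑ τ ∈ T, B s τ) (∑ τ ∈ T, B' τ) t := HasDerivAt.fun_sum hB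
  exact (hSB.log hZB).sub (hSA.log hZA)

/-- **ENDPOINT RESPONSE IDENTITY** [algebra]: with `p = A∕Z_A`, `q = B∕Z_B` the two ONE-RUN class laws,
`Z_B'∕Z_B − Z_A'∕Z_A = E_q[B'∕B − A'∕A] + (E_q[A'∕A] − E_p[A'∕A])` — the RESPONSE of the increment `∂h = ∂log B − ∂log A` under run B's law,
plus the COUPLING term: the run-A source current `j = ∂log A` tested against the difference of the two one-run laws.  No interpolated ensemble. -/
theorem response_split {A B A' B' : ι → ℝ} (hA : ∀ τ ∈ T, A τ ≠ 0) (hB : ∀ τ ∈ T, B τ ≠ 0) :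
    (∑ τ ∈ T, B' τ) / (∑ τ ∈ T, B τ) - (∑ τ ∈ T, A' τ) / (∑ τ ∈ T, A τ)
      = ∑ τ ∈ T, B τ / (∑ σ ∈ T, B σ) * (B' τ / B τ - A' τ / A τ)
        + (∑ τ ∈ T, B τ / (∑ σ ∈ T, B σ) * (A' τ / A τ) - ∑ τ ∈ T, A τ / (∑ σ ∈ T, A σ) * (A' τ / A τ)) := by
  have e1 : ∑ τ ∈ T, B τ / (∑ σ ∈ T, B σ) * (B' τ / B τ) = (∑ τ ∈ T, B' τ) / ∑ σ ∈ T, B σ := by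
    rw [sum_div]
    exact sum_congr rfl fun τ hτ => by rw [div_mul_div_comm, mul_comm (B τ) (B' τ), mul_div_mul_right _ _ (hB τ hτ)]
  have e2 : ∑ τ ∈ T, A τ / (∑ σ ∈ T, A σ) * (A' τ / A τ) = (∑ τ ∈ T, A' τ) / ∑ σ ∈ T, A σ := by
    rw [sum_div]
    exact sum_congr rfl fun τ hτ => by rw [div_mul_div_comm, mul_comm (A τ) (A' τ), mul_div_mul_right _ _ (hA τ hτ)]
  have e3 : ∑ τ ∈ T, B τ / (∑ σ ∈ T, B σ) * (B' τ / B τ - A' τ / A τ)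
      = ∑ τ ∈ T, B τ / (∑ σ ∈ T, B σ) * (B' τ / B τ) - ∑ τ ∈ T, B τ / (∑ σ ∈ T, B σ) * (A' τ / A τ) := by
    rw [← sum_sub_distrib]
    exact sum_congr rfl fun τ _ => by ring
  rw [e3, e1, e2]
  ring

/-- **ONE-`(K,t)` KERNEL OF K2** [folklore]: `|Z_B'∕Z_B − Z_A'∕Z_A| ≤ |E_q[∂h]| + 2√(2(1 − bc(p,q)))·√(Σ ½(p+q)(j − c)²)` with `∂h = B'∕B − A'∕A`,
`j = A'∕A` and any centring `c` — the response of the target constant to the source is the ONE-RUN-LAW expectation of the increment's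
derivative plus (Hellinger functional of K1) × (one-run source susceptibility, R-c). -/
theorem abs_response_le {A B : ι → ℝ} (hA : ∀ τ ∈ T, 0 < A τ) (hB : ∀ τ ∈ T, 0 < B τ)
    (hZA : 0 < ∑ τ ∈ T, A τ) (hZB : 0 < ∑ τ ∈ T, B τ) (A' B' : ι → ℝ) (c : ℝ) :
    |(∑ τ ∈ T, B' τ) / (∑ τ ∈ T, B τ) - (∑ τ ∈ T, A' τ) / (∑ τ ∈ T, A τ)|
      ≤ |∑ τ ∈ T, B τ / (∑ σ ∈ T, B σ) * (B' τ / B τ - A' τ / A τ)|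
        + 2 * Real.sqrt (2 * (1 - bc T (fun τ => A τ / ∑ σ ∈ T, A σ) (fun τ => B τ / ∑ σ ∈ T, B σ)))
          * Real.sqrt (∑ τ ∈ T, (A τ / (∑ σ ∈ T, A σ) + B τ / (∑ σ ∈ T, B σ)) / 2 * (A' τ / A τ - c) ^ 2) := by
  have hp : ∀ τ ∈ T, 0 ≤ A τ / ∑ σ ∈ T, A σ := fun τ hτ => div_nonneg (hA τ hτ).le hZA.le
  have hq : ∀ τ ∈ T, 0 ≤ B τ / ∑ σ ∈ T, B σ := fun τ hτ => div_nonneg (hB τ hτ).le hZB.le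
  have hp1 : ∑ τ ∈ T, A τ / ∑ σ ∈ T, A σ = 1 := by rw [← sum_div, div_self hZA.ne']
  have hq1 : ∑ τ ∈ T, B τ / ∑ σ ∈ T, B σ = 1 := by rw [← sum_div, div_self hZB.ne']
  rw [response_split (fun τ hτ => (hA τ hτ).ne') (fun τ hτ => (hB τ hτ).ne')]
  have hc := abs_sum_sub_sum_le_hellinger hp hq hp1 hq1 (fun τ => A' τ / A τ) c
  exact (abs_add_le _ _).trans (add_le_add le_rfl hc)

/-- **MEAN-VALUE STEP TO THE TARGET SHAPE** [folklore]: a function differentiable on `|s| ≤ l₀` with `|c'| ≤ r` there is matched modulo the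
constant `c 0` within `r·l₀` — the `∀ t, |t| ≤ l₀ → |c_K(t) − c_K| ≤ vol·δ_K` shape of `T4CauchySum.MatchingModConstants` at one `K`,
with `vol·δ_K = l₀ · sup_{|t|≤l₀} |c_K'(t)|`. -/
theorem matching_of_derivative_bound {l₀ r : ℝ} {c c' : ℝ → ℝ} (hl₀ : 0 ≤ l₀)
    (hc : ∀ s, |s| ≤ l₀ → HasDerivAt c (c' s) s) (hb : ∀ s, |s| ≤ l₀ → |c' s| ≤ r) :
    ∃ c₀ : ℝ, ∀ t, |t| ≤ l₀ → |c t - c₀| ≤ r * l₀ := by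
  refine ⟨c 0, fun t ht => ?_⟩
  have hmem : ∀ {s : ℝ}, s ∈ Set.Icc (-l₀) l₀ ↔ |s| ≤ l₀ := fun {s} => by rw [Set.mem_Icc, abs_le]
  have h0 : |(0:ℝ)| ≤ l₀ := by simpa using hl₀
  have key : ‖c t - c 0‖ ≤ r * ‖t - 0‖ :=
    (convex_Icc (-l₀) l₀).norm_image_sub_le_of_norm_hasDerivWithin_le
      (fun s hs => (hc s (hmem.mp hs)).hasDerivWithinAt)
      (fun s hs => by rw [Real.norm_eq_abs]; exact hb s (hmem.mp hs))
      (hmem.mpr h0) (hmem.mpr ht)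
  rw [Real.norm_eq_abs, Real.norm_eq_abs, sub_zero] at key
  have hr : 0 ≤ r := (abs_nonneg _).trans (hb 0 h0)
  exact key.trans (mul_le_mul_of_nonneg_left ht hr)

end Endpoint

/-! ## §11 ONE-RUN VARIANCE SUPPLY (edition 3): analyticity of the TILTED CLASS FREE ENERGY in a complex disc bounds `Var_p(h)`
[folklore: Cauchy estimates] — the card's FIRST UNCHECKED LEMMA of edition 2, now kernel-checked, and its composition with §10

For ONE run's class weights `A > 0` and a real class observable `h`: if `φ`, with `e^{φ(s)} = Σ_τ A_τ e^{s h_τ} ∕ Σ_τ A_τ`, has an analytic branch on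
`|s| ≤ r` bounded by `B`, then `Var_{A∕Z_A}(h) = φ″(0)` (differentiate `e^{φ} =` tilted sum twice at `0`: `φ′ = ψ′∕ψ`) and `|φ″(0)| ≤ (B∕(r∕2))∕(r∕2)`
(Mathlib's `Complex.norm_deriv_le_of_forall_mem_sphere_norm_le` twice).  This is the SHAPE in which a one-run convergent expansion delivers —
holomorphy and an additive bound of `log Z` in a complex coupling: the tree's KERNEL-PROVED Kotecký–Preiss logarithm
(`T4DilationKPLog.logZ_differentiableOn_and_bound`, `Literature.Probability.LatticeModels.exp_polymerLogZ_of_kp`) is wired in BY NAME below.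
READING for the card (honest): for `h = log B − log A` the tilt of run A's class law by `e^{s h}` is the complexified interpolated free energy
`log Z(s) − log Z_A`, `Z(s) = Σ A^{1−s}B^s`; its ONE-RUN provenance is run A's keyed class ensemble with LOCAL action perturbed by `s·(F_B − F_A)`, so with
`η = ‖F_B − F_A‖_loc` (the two-run letter, U2∕NE5 currency) and `(r₀, B)` the one-run analyticity modulus under complex local perturbations of norm
`≤ r₀` one gets `r = r₀∕η` and `Var ≤ 4Bη²∕r₀²` (`variance_le_of_analytic_tilt_scaled`); `B` is extensive in the (FIXED, finite-𝕋⁴) unit-lattice volume. -/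

section Tilt

/-- **FIRST LEMMA OF THE CARD (ed.2), PROVED** [folklore]: the variance of `h` under the law `A∕Z_A` is at most `4B∕r²` whenever the tilted
log-partition function `φ` (`e^{φ(s)} = Σ A e^{s h}∕Σ A`) is complex-differentiable on the closed disc of radius `r` and bounded by `B` there.
(The card's extra hypothesis `φ 0 = 0` is not needed: `e^{φ(0)} = 1` already pins `ψ(0) = 1`, which is all the log-derivative identity uses.) -/
theorem variance_le_of_analytic_tilt (T : Finset ι) (A h : ι → ℝ) (hA : ∀ τ ∈ T, 0 < A τ)
    {r B : ℝ} (hr : 0 < r) (φ : ℂ → ℂ) (hφ : DifferentiableOn ℂ φ (Metric.closedBall 0 r))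
    (hexp : ∀ s ∈ Metric.closedBall (0:ℂ) r,
      Complex.exp (φ s) = (∑ τ ∈ T, (A τ : ℂ) * Complex.exp (s * (h τ : ℂ))) / ∑ τ ∈ T, (A τ : ℂ))
    (hB : ∀ s ∈ Metric.closedBall (0:ℂ) r, ‖φ s‖ ≤ B) :
    (∑ τ ∈ T, A τ * (h τ - (∑ σ ∈ T, A σ * h σ) / ∑ σ ∈ T, A σ) ^ 2) / (∑ τ ∈ T, A τ) ≤ 4 * B / r ^ 2 := by
  have hB0 : 0 ≤ B := le_trans (norm_nonneg _) (hB 0 (Metric.mem_closedBall_self hr.le))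
  rcases T.eq_empty_or_nonempty with hT | hT
  · subst hT; simp; positivity
  -- Step 1: first Cauchy estimate on circles of radius `r/2` centred in the closed half-disc.
  have h1 : ∀ w ∈ Metric.closedBall (0:ℂ) (r / 2), ‖deriv φ w‖ ≤ B / (r / 2) := by
    intro w hw
    have hsub : Metric.closedBall w (r / 2) ⊆ Metric.closedBall 0 r :=
      Metric.closedBall_subset_closedBall' (by
        rw [dist_zero_right]; have := mem_closedBall_zero_iff.mp hw; linarith)
    exact Complex.norm_deriv_le_of_forall_mem_sphere_norm_le (half_pos hr) (hφ.diffContOnCl_ball hsub)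
      (fun z hz => hB z (hsub (Metric.sphere_subset_closedBall hz)))
  -- Step 2: second Cauchy estimate, for `deriv φ` (analytic on the open disc), on the circle of radius `r/2` about `0`.
  have hball : DifferentiableOn ℂ φ (Metric.ball 0 r) := hφ.mono Metric.ball_subset_closedBall
  have hder : DifferentiableOn ℂ (deriv φ) (Metric.ball 0 r) :=
    (hball.analyticOnNhd Metric.isOpen_ball).deriv.differentiableOn
  have h2 : ‖deriv (deriv φ) 0‖ ≤ (B / (r / 2)) / (r / 2) :=
    Complex.norm_deriv_le_of_forall_mem_sphere_norm_le (half_pos hr)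
      (hder.diffContOnCl_ball (Metric.closedBall_subset_ball (half_lt_self hr)))
      (fun z hz => h1 z (Metric.sphere_subset_closedBall hz))
  have h2' : ‖deriv (deriv φ) 0‖ ≤ 4 * B / r ^ 2 := by
    have : (B / (r / 2)) / (r / 2) = 4 * B / r ^ 2 := by field_simp; ring
    rw [← this]; exact h2
  -- Step 3: `φ″(0) = Var`, by differentiating `exp ∘ φ = ψ` (the tilted sum over `Z`) twice at `0`.
  have hZpos : 0 < ∑ τ ∈ T, A τ := Finset.sum_pos hA hT
  have hZc : (∑ τ ∈ T, (A τ : ℂ)) = ((∑ τ ∈ T, A τ : ℝ) : ℂ) := by push_cast; rfl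
  have hZne : (∑ τ ∈ T, (A τ : ℂ)) ≠ 0 := by rw [hZc]; exact Complex.ofReal_ne_zero.mpr hZpos.ne'
  set ψ : ℂ → ℂ := fun s => (∑ τ ∈ T, (A τ : ℂ) * Complex.exp (s * (h τ : ℂ))) / ∑ τ ∈ T, (A τ : ℂ) with hψ
  set ψ₁ : ℂ → ℂ := fun s => (∑ τ ∈ T, (A τ : ℂ) * (Complex.exp (s * (h τ : ℂ)) * (h τ : ℂ))) / ∑ τ ∈ T, (A τ : ℂ)
    with hψ₁
  set ψ₂ : ℂ → ℂ :=
    fun s => (∑ τ ∈ T, (A τ : ℂ) * (Complex.exp (s * (h τ : ℂ)) * (h τ : ℂ) * (h τ : ℂ))) / ∑ τ ∈ T, (A τ : ℂ)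
    with hψ₂
  have D1 : ∀ s, HasDerivAt ψ (ψ₁ s) s := fun s => by
    have : ∀ τ ∈ T, HasDerivAt (fun s => (A τ : ℂ) * Complex.exp (s * (h τ : ℂ)))
        ((A τ : ℂ) * (Complex.exp (s * (h τ : ℂ)) * (h τ : ℂ))) s :=
      fun τ _ => ((hasDerivAt_mul_const (h τ : ℂ)).cexp).const_mul (A τ : ℂ)
    exact (HasDerivAt.fun_sum this).div_const _
  have D2 : ∀ s, HasDerivAt ψ₁ (ψ₂ s) s := fun s => by
    have : ∀ τ ∈ T, HasDerivAt (fun s => (A τ : ℂ) * (Complex.exp (s * (h τ : ℂ)) * (h τ : ℂ)))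
        ((A τ : ℂ) * (Complex.exp (s * (h τ : ℂ)) * (h τ : ℂ) * (h τ : ℂ))) s :=
      fun τ _ => (((hasDerivAt_mul_const (h τ : ℂ)).cexp).mul_const (h τ : ℂ)).const_mul (A τ : ℂ)
    exact (HasDerivAt.fun_sum this).div_const _
  have hψ0 : ψ 0 = 1 := by simp [hψ, div_self hZne]
  have hψ₁0 : ψ₁ 0 = (∑ τ ∈ T, (A τ : ℂ) * (h τ : ℂ)) / ∑ τ ∈ T, (A τ : ℂ) := by simp [hψ₁]
  have hψ₂0 : ψ₂ 0 = (∑ τ ∈ T, (A τ : ℂ) * ((h τ : ℂ) * (h τ : ℂ))) / ∑ τ ∈ T, (A τ : ℂ) := by simp [hψ₂]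
  -- log-derivative identity on the open disc: `deriv φ = ψ₁ / ψ`
  have hlog : ∀ s ∈ Metric.ball (0:ℂ) r, deriv φ s = ψ₁ s / ψ s := by
    intro s hs
    have hds : HasDerivAt φ (deriv φ s) s :=
      (hφ.differentiableAt (Filter.mem_of_superset (Metric.isOpen_ball.mem_nhds hs)
        Metric.ball_subset_closedBall)).hasDerivAt
    have he : HasDerivAt (fun s => Complex.exp (φ s)) (Complex.exp (φ s) * deriv φ s) s := hds.cexp
    have heq : ψ =ᶠ[nhds s] (fun s => Complex.exp (φ s)) :=
      Filter.eventuallyEq_of_mem (Metric.isOpen_ball.mem_nhds hs)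
        (fun z hz => (hexp z (Metric.ball_subset_closedBall hz)).symm)
    have hψs : HasDerivAt ψ (Complex.exp (φ s) * deriv φ s) s := he.congr_of_eventuallyEq heq
    have hexp' : Complex.exp (φ s) = ψ s := hexp s (Metric.ball_subset_closedBall hs)
    have huniq : ψ₁ s = Complex.exp (φ s) * deriv φ s := (D1 s).unique hψs
    rw [hexp'] at huniq
    have hψne : ψ s ≠ 0 := by rw [← hexp']; exact Complex.exp_ne_zero _
    rw [eq_div_iff hψne, huniq]
    exact mul_comm _ _
  have hdd : deriv (deriv φ) 0 = deriv (fun s => ψ₁ s / ψ s) 0 :=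
    Filter.EventuallyEq.deriv_eq (Filter.eventuallyEq_of_mem
      (Metric.isOpen_ball.mem_nhds (Metric.mem_ball_self hr)) (fun s hs => hlog s hs))
  have D5 : HasDerivAt (fun s => ψ₁ s / ψ s) ((ψ₂ 0 * ψ 0 - ψ₁ 0 * ψ₁ 0) / ψ 0 ^ 2) 0 :=
    (D2 0).div (D1 0) (by rw [hψ0]; exact one_ne_zero)
  have hV : deriv (deriv φ) 0 = ψ₂ 0 - ψ₁ 0 * ψ₁ 0 := by rw [hdd, D5.deriv, hψ0]; ring
  -- the real variance identity `Σ A(h − m)²∕Z = Σ A h²∕Z − m²`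
  set Z : ℝ := ∑ τ ∈ T, A τ with hZ
  set S₁ : ℝ := ∑ τ ∈ T, A τ * h τ with hS₁
  set S₂ : ℝ := ∑ τ ∈ T, A τ * (h τ * h τ) with hS₂
  have hvar : (∑ τ ∈ T, A τ * (h τ - S₁ / Z) ^ 2) / Z = S₂ / Z - (S₁ / Z) ^ 2 := by
    have key : ∑ τ ∈ T, A τ * (h τ - S₁ / Z) ^ 2 = S₂ - 2 * (S₁ / Z) * S₁ + (S₁ / Z) ^ 2 * Z := by
      rw [hS₂, hS₁, hZ, Finset.mul_sum, Finset.mul_sum, ← Finset.sum_sub_distrib, ← Finset.sum_add_distrib]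
      exact Finset.sum_congr rfl (fun τ _ => by ring)
    rw [key]; field_simp; ring
  have hVreal : deriv (deriv φ) 0 = ((S₂ / Z - (S₁ / Z) ^ 2 : ℝ) : ℂ) := by
    rw [hV, hψ₁0, hψ₂0, hS₂, hS₁, hZ]; push_cast; ring
  calc (∑ τ ∈ T, A τ * (h τ - S₁ / Z) ^ 2) / Z = S₂ / Z - (S₁ / Z) ^ 2 := hvar
    _ ≤ ‖((S₂ / Z - (S₁ / Z) ^ 2 : ℝ) : ℂ)‖ := by
        rw [Complex.norm_real, Real.norm_eq_abs]; exact le_abs_self _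
    _ = ‖deriv (deriv φ) 0‖ := by rw [hVreal]
    _ ≤ 4 * B / r ^ 2 := h2'

/-- The same in CLASS-LAW form [folklore]: with `p = A∕Z_A` the one-run class law, `Σ p(h − E_p h)² ≤ 4B∕r²` — the `Var_p h` letter of §10's
`mixture_moment_le_of_regime`. -/
theorem variance_classLaw_le_of_analytic_tilt {A : ι → ℝ} (hA : ∀ τ ∈ T, 0 < A τ) (h : ι → ℝ)
    {r B : ℝ} (hr : 0 < r) (φ : ℂ → ℂ) (hφ : DifferentiableOn ℂ φ (Metric.closedBall 0 r))
    (hexp : ∀ s ∈ Metric.closedBall (0:ℂ) r,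
      Complex.exp (φ s) = (∑ τ ∈ T, (A τ : ℂ) * Complex.exp (s * (h τ : ℂ))) / ∑ τ ∈ T, (A τ : ℂ))
    (hB : ∀ s ∈ Metric.closedBall (0:ℂ) r, ‖φ s‖ ≤ B) :
    ∑ τ ∈ T, A τ / (∑ σ ∈ T, A σ) * (h τ - ∑ σ ∈ T, A σ / (∑ σ' ∈ T, A σ') * h σ) ^ 2 ≤ 4 * B / r ^ 2 := by
  have e1 : ∑ σ ∈ T, A σ / (∑ σ' ∈ T, A σ') * h σ = (∑ σ ∈ T, A σ * h σ) / ∑ σ ∈ T, A σ := by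
    rw [sum_div]; exact sum_congr rfl fun _ _ => by ring
  have e2 : ∀ m : ℝ, ∑ τ ∈ T, A τ / (∑ σ ∈ T, A σ) * (h τ - m) ^ 2
      = (∑ τ ∈ T, A τ * (h τ - m) ^ 2) / ∑ τ ∈ T, A τ := fun m => by
    rw [sum_div]; exact sum_congr rfl fun _ _ => by ring
  rw [e1, e2]
  exact variance_le_of_analytic_tilt T A h hA hr φ hφ hexp hB

/-- **SCALING** [folklore]: if the observable is `h = η·u` and the tilt by `u` has modulus `(r₀, B)` — `e^{G(ζ)} = Σ A e^{ζ u}∕Σ A` analytic with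
`|G| ≤ B` on `|ζ| ≤ r₀` — then `Var_{A∕Z_A}(h) ≤ 4B·η²∕r₀²`: the size `η` of the (two-run) increment enters ONLY through the radius `r = r₀∕η`,
quadratically, against ONE-run constants `(r₀, B)`. -/
theorem variance_le_of_analytic_tilt_scaled (T : Finset ι) (A u : ι → ℝ) (hA : ∀ τ ∈ T, 0 < A τ)
    {r₀ B η : ℝ} (hr₀ : 0 < r₀) (hη : 0 < η) (G : ℂ → ℂ) (hG : DifferentiableOn ℂ G (Metric.closedBall 0 r₀))
    (hexp : ∀ ζ ∈ Metric.closedBall (0:ℂ) r₀,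
      Complex.exp (G ζ) = (∑ τ ∈ T, (A τ : ℂ) * Complex.exp (ζ * (u τ : ℂ))) / ∑ τ ∈ T, (A τ : ℂ))
    (hB : ∀ ζ ∈ Metric.closedBall (0:ℂ) r₀, ‖G ζ‖ ≤ B) :
    (∑ τ ∈ T, A τ * (η * u τ - (∑ σ ∈ T, A σ * (η * u σ)) / ∑ σ ∈ T, A σ) ^ 2) / (∑ τ ∈ T, A τ)
      ≤ 4 * B * η ^ 2 / r₀ ^ 2 := by
  have hmem : ∀ s ∈ Metric.closedBall (0:ℂ) (r₀ / η), (η : ℂ) * s ∈ Metric.closedBall (0:ℂ) r₀ := by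
    intro s hs
    rw [mem_closedBall_zero_iff] at hs ⊢
    rw [norm_mul, Complex.norm_real, Real.norm_eq_abs, abs_of_pos hη]
    calc η * ‖s‖ ≤ η * (r₀ / η) := mul_le_mul_of_nonneg_left hs hη.le
      _ = r₀ := by field_simp
  have hdiff : DifferentiableOn ℂ (fun s => G ((η : ℂ) * s)) (Metric.closedBall 0 (r₀ / η)) :=
    hG.comp ((differentiable_id.const_mul (η : ℂ)).differentiableOn) hmem
  have key := variance_le_of_analytic_tilt T A (fun τ => η * u τ) hA (div_pos hr₀ hη) (fun s => G ((η : ℂ) * s)) hdiff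
    (fun s hs => by
      rw [hexp _ (hmem s hs)]
      congr 1
      refine sum_congr rfl fun τ _ => ?_
      have e : ((η : ℂ) * s * (u τ : ℂ)) = s * ((η * u τ : ℝ) : ℂ) := by push_cast; ring
      rw [e])
    (fun s hs => hB _ (hmem s hs))
  calc _ ≤ 4 * B / (r₀ / η) ^ 2 := key
    _ = 4 * B * η ^ 2 / r₀ ^ 2 := by rw [div_pow, div_div_eq_mul_div]

open Literature.Probability.LatticeModels (polymerLogZ exp_polymerLogZ_of_kp) in
open Literature.MathematicalPhysics.QuantumFieldTheory.Balaban1983to89.T4DilationKP (IsKPOn cZ) in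
open Literature.MathematicalPhysics.QuantumFieldTheory.Balaban1983to89.T4DilationKPLog (logZ_differentiableOn_and_bound) in
/-- **THE KOTECKÝ–PREISS PROVIDER, BY NAME** [folklore, on the tree's kernel-proved KP logarithm]: if the tilted class sum is a RATIO OF POLYMER
PARTITION FUNCTIONS `Z(Λ; w(·,s))∕Z(Λ; w(·,0))` (`T4DilationKP.cZ`) whose activities are holomorphic in the tilt parameter and satisfy the
Kotecký–Preiss condition UNIFORMLY on the closed disc `|s| ≤ r` (`T4DilationKP.IsKPOn`), then `Var_{A∕Z_A}(h) ≤ 8(Σ_{γ∈Λ} a γ)∕r²`: the branch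
is the tree's `polymerLogZ` (`exp_polymerLogZ_of_kp`), holomorphic with `‖log Z‖ ≤ Σ a` (`T4DilationKPLog.logZ_differentiableOn_and_bound`).
This is the EXACT SHAPE in which a one-run convergent expansion feeds §10's V-side.  The representation hypothesis `hrep` is where the modelling sits. -/
theorem variance_le_of_kpTilt {P : Type*} [DecidableEq P] {inc : P → P → Prop} [DecidableRel inc] [Std.Refl inc] [Std.Symm inc]
    (T : Finset ι) (A h : ι → ℝ) (hA : ∀ τ ∈ T, 0 < A τ) {r : ℝ} (hr : 0 < r)
    (w : P → ℂ → ℂ) (a : P → ℝ) (Λ : Finset P)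
    (hw : ∀ γ ∈ Λ, DifferentiableOn ℂ (w γ) (Metric.closedBall 0 r)) (hKP : IsKPOn inc w a Λ (Metric.closedBall 0 r))
    (hrep : ∀ s ∈ Metric.closedBall (0:ℂ) r,
      (∑ τ ∈ T, (A τ : ℂ) * Complex.exp (s * (h τ : ℂ))) / ∑ τ ∈ T, (A τ : ℂ) = cZ inc w Λ s / cZ inc w Λ 0) :
    (∑ τ ∈ T, A τ * (h τ - (∑ σ ∈ T, A σ * h σ) / ∑ σ ∈ T, A σ) ^ 2) / (∑ τ ∈ T, A τ)
      ≤ 8 * (∑ γ ∈ Λ, a γ) / r ^ 2 := by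
  obtain ⟨hdiff, hbd⟩ := logZ_differentiableOn_and_bound (inc := inc) hw hKP
  have h0 : (0:ℂ) ∈ Metric.closedBall (0:ℂ) r := Metric.mem_closedBall_self hr.le
  have key := variance_le_of_analytic_tilt T A h hA hr
    (fun s => polymerLogZ inc (fun γ => w γ s) Λ - polymerLogZ inc (fun γ => w γ 0) Λ) (hdiff.sub_const _)
    (fun s hs => by
      rw [hrep s hs, Complex.exp_sub, exp_polymerLogZ_of_kp (hKP s hs) (Finset.Subset.refl Λ),
        exp_polymerLogZ_of_kp (hKP 0 h0) (Finset.Subset.refl Λ)]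
      rfl)
    (fun s hs =>
      calc ‖polymerLogZ inc (fun γ => w γ s) Λ - polymerLogZ inc (fun γ => w γ 0) Λ‖
          ≤ ‖polymerLogZ inc (fun γ => w γ s) Λ‖ + ‖polymerLogZ inc (fun γ => w γ 0) Λ‖ := norm_sub_le _ _
        _ ≤ (∑ γ ∈ Λ, a γ) + ∑ γ ∈ Λ, a γ := add_le_add (hbd s hs) (hbd 0 h0)
        _ = 2 * ∑ γ ∈ Λ, a γ := by ring)
  calc _ ≤ 4 * (2 * ∑ γ ∈ Λ, a γ) / r ^ 2 := key
    _ = 8 * (∑ γ ∈ Λ, a γ) / r ^ 2 := by ring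

/-- **THE PERTURBATIVE REGIME FROM COARSE DATA** [folklore]: wild mass `≤ 3∕64` and a UNIFORM (not small-in-`K`) closeness `|h_τ − c| ≤ ¼` of the
centred increment on the tame classes give `1 − bc ≤ 1∕16` (`one_sub_bc_classLaw_le_wild_add_moment` with `(h − c)² ≤ 1∕16` and `Σ(p+q) = 2`). -/
theorem regime_of_wild_add_sup [DecidableEq ι] {A B : ι → ℝ}
    (hA : ∀ τ ∈ T, 0 < A τ) (hB : ∀ τ ∈ T, 0 < B τ) (hZA : 0 < ∑ τ ∈ T, A τ) (hZB : 0 < ∑ τ ∈ T, B τ)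
    {W : Finset ι} (hW : W ⊆ T)
    (hwild : (∑ τ ∈ W, (A τ / (∑ σ ∈ T, A σ) + B τ / (∑ σ ∈ T, B σ))) / 2 ≤ 3 / 64)
    (hsup : ∀ τ ∈ T \ W, |(Real.log (B τ) - Real.log (A τ)) - (Real.log (∑ σ ∈ T, B σ) - Real.log (∑ σ ∈ T, A σ))| ≤ 1 / 4) :
    1 - bc T (fun τ => A τ / ∑ σ ∈ T, A σ) (fun τ => B τ / ∑ σ ∈ T, B σ) ≤ 1 / 16 := by
  have h1 := one_sub_bc_classLaw_le_wild_add_moment hA hB hZA hZB hW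
  have hp : ∀ τ ∈ T, 0 ≤ A τ / ∑ σ ∈ T, A σ := fun τ hτ => div_nonneg (hA τ hτ).le hZA.le
  have hq : ∀ τ ∈ T, 0 ≤ B τ / ∑ σ ∈ T, B σ := fun τ hτ => div_nonneg (hB τ hτ).le hZB.le
  have hp1 : ∑ τ ∈ T, A τ / ∑ σ ∈ T, A σ = 1 := by rw [← sum_div, div_self hZA.ne']
  have hq1 : ∑ τ ∈ T, B τ / ∑ σ ∈ T, B σ = 1 := by rw [← sum_div, div_self hZB.ne']
  have h2 : ∑ τ ∈ T \ W, (A τ / (∑ σ ∈ T, A σ) + B τ / (∑ σ ∈ T, B σ))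
        * ((Real.log (B τ) - Real.log (A τ)) - (Real.log (∑ σ ∈ T, B σ) - Real.log (∑ σ ∈ T, A σ))) ^ 2
      ≤ ∑ τ ∈ T, (A τ / (∑ σ ∈ T, A σ) + B τ / (∑ σ ∈ T, B σ)) * (1 / 16) := by
    calc _ ≤ ∑ τ ∈ T \ W, (A τ / (∑ σ ∈ T, A σ) + B τ / (∑ σ ∈ T, B σ)) * (1 / 16) := by
          refine sum_le_sum fun τ hτ => mul_le_mul_of_nonneg_left ?_
            (add_nonneg (hp τ (sdiff_subset hτ)) (hq τ (sdiff_subset hτ)))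
          have hs := hsup τ hτ
          have : ((Real.log (B τ) - Real.log (A τ)) - (Real.log (∑ σ ∈ T, B σ) - Real.log (∑ σ ∈ T, A σ))) ^ 2
              = |(Real.log (B τ) - Real.log (A τ)) - (Real.log (∑ σ ∈ T, B σ) - Real.log (∑ σ ∈ T, A σ))| ^ 2 :=
            (sq_abs _).symm
          rw [this]
          nlinarith [abs_nonneg ((Real.log (B τ) - Real.log (A τ)) - (Real.log (∑ σ ∈ T, B σ) - Real.log (∑ σ ∈ T, A σ)))]
      _ ≤ _ := sum_le_sum_of_subset_of_nonneg sdiff_subset fun τ hτ _ =>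
          mul_nonneg (add_nonneg (hp τ hτ) (hq τ hτ)) (by norm_num)
  have h3 : ∑ τ ∈ T, (A τ / (∑ σ ∈ T, A σ) + B τ / (∑ σ ∈ T, B σ)) * (1 / 16) = 2 * (1 / 16) := by
    rw [← sum_mul, sum_add_distrib, hp1, hq1]; ring
  rw [h3] at h2
  linarith

/-- **THE ONE-`(K,t)` V-SIDE KERNEL ON ONE-RUN TILT DATA** [folklore]: for positive class weights `A, B` of the two runs at a key, a wild set
`W ⊆ T`, and analytic tilts of BOTH runs' class laws by the increment `h = log B − log A` with common radius `r` and bounds `B_A, B_B`, in the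
perturbative regime `1 − bc ≤ 1∕16` (see `regime_of_wild_add_sup`):
`1 − bc(p,q) ≤ ½(p(W) + q(W)) + (B_A + B_B)∕r²` — WILD MASS + TILT BOUNDS; the centring `c = log Z_B − log Z_A` between the two means is §6b's
`gibbs_bogoliubov_sandwich`, the moment is §10's `mixture_moment_le_of_regime`, the variances are `variance_classLaw_le_of_analytic_tilt` twice.
No interpolated ensemble is evaluated; no bad-class dial; no shell weight. -/
theorem one_sub_bc_classLaw_le_wild_add_tilts [DecidableEq ι] {A B : ι → ℝ}
    (hA : ∀ τ ∈ T, 0 < A τ) (hB : ∀ τ ∈ T, 0 < B τ) {W : Finset ι} (hW : W ⊆ T)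
    {r BA BB : ℝ} (hr : 0 < r) (φA φB : ℂ → ℂ)
    (hφA : DifferentiableOn ℂ φA (Metric.closedBall 0 r)) (hφB : DifferentiableOn ℂ φB (Metric.closedBall 0 r))
    (hexpA : ∀ s ∈ Metric.closedBall (0:ℂ) r, Complex.exp (φA s)
      = (∑ τ ∈ T, (A τ : ℂ) * Complex.exp (s * ((Real.log (B τ) - Real.log (A τ) : ℝ) : ℂ))) / ∑ τ ∈ T, (A τ : ℂ))
    (hexpB : ∀ s ∈ Metric.closedBall (0:ℂ) r, Complex.exp (φB s)
      = (∑ τ ∈ T, (B τ : ℂ) * Complex.exp (s * ((Real.log (B τ) - Real.log (A τ) : ℝ) : ℂ))) / ∑ τ ∈ T, (B τ : ℂ))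
    (hbA : ∀ s ∈ Metric.closedBall (0:ℂ) r, ‖φA s‖ ≤ BA) (hbB : ∀ s ∈ Metric.closedBall (0:ℂ) r, ‖φB s‖ ≤ BB)
    (hreg : 1 - bc T (fun τ => A τ / ∑ σ ∈ T, A σ) (fun τ => B τ / ∑ σ ∈ T, B σ) ≤ 1 / 16) :
    1 - bc T (fun τ => A τ / ∑ σ ∈ T, A σ) (fun τ => B τ / ∑ σ ∈ T, B σ)
      ≤ (∑ τ ∈ W, (A τ / (∑ σ ∈ T, A σ) + B τ / (∑ σ ∈ T, B σ))) / 2 + (BA + BB) / r ^ 2 := by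
  rcases T.eq_empty_or_nonempty with hT | hne
  · exfalso; subst hT; simp [bc] at hreg; norm_num at hreg
  have hZA : 0 < ∑ τ ∈ T, A τ := sum_pos hA hne
  have hZB : 0 < ∑ τ ∈ T, B τ := sum_pos hB hne
  have hp : ∀ τ ∈ T, 0 ≤ A τ / ∑ σ ∈ T, A σ := fun τ hτ => div_nonneg (hA τ hτ).le hZA.le
  have hq : ∀ τ ∈ T, 0 ≤ B τ / ∑ σ ∈ T, B σ := fun τ hτ => div_nonneg (hB τ hτ).le hZB.le
  have hp1 : ∑ τ ∈ T, A τ / ∑ σ ∈ T, A σ = 1 := by rw [← sum_div, div_self hZA.ne']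
  have hq1 : ∑ τ ∈ T, B τ / ∑ σ ∈ T, B σ = 1 := by rw [← sum_div, div_self hZB.ne']
  -- the centring lies between the two means (§6b)
  have hsand := gibbs_bogoliubov_sandwich hA hB hZA hZB
  have eA : ∑ τ ∈ T, A τ / (∑ σ ∈ T, A σ) * (Real.log (B τ) - Real.log (A τ))
      = (∑ τ ∈ T, A τ * (Real.log (B τ) - Real.log (A τ))) / ∑ σ ∈ T, A σ := by
    rw [sum_div]; exact sum_congr rfl fun _ _ => by ring
  have eB : ∑ τ ∈ T, B τ / (∑ σ ∈ T, B σ) * (Real.log (B τ) - Real.log (A τ))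
      = (∑ τ ∈ T, B τ * (Real.log (B τ) - Real.log (A τ))) / ∑ σ ∈ T, B σ := by
    rw [sum_div]; exact sum_congr rfl fun _ _ => by ring
  have hlo : ∑ τ ∈ T, A τ / (∑ σ ∈ T, A σ) * (Real.log (B τ) - Real.log (A τ))
      ≤ Real.log (∑ σ ∈ T, B σ) - Real.log (∑ σ ∈ T, A σ) := by rw [eA]; exact hsand.1
  have hhi : Real.log (∑ σ ∈ T, B σ) - Real.log (∑ σ ∈ T, A σ)
      ≤ ∑ τ ∈ T, B τ / (∑ σ ∈ T, B σ) * (Real.log (B τ) - Real.log (A τ)) := by rw [eB]; exact hsand.2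
  -- §10 moment bootstrap in the regime, and the two one-run variances from the tilts
  have hM := mixture_moment_le_of_regime (T := T) (p := fun τ => A τ / ∑ σ ∈ T, A σ) (q := fun τ => B τ / ∑ σ ∈ T, B σ)
    hp hq hp1 hq1 (fun τ => Real.log (B τ) - Real.log (A τ)) hlo hhi hreg
  have hVA := variance_classLaw_le_of_analytic_tilt (T := T) hA (fun τ => Real.log (B τ) - Real.log (A τ)) hr φA hφA hexpA hbA
  have hVB := variance_classLaw_le_of_analytic_tilt (T := T) hB (fun τ => Real.log (B τ) - Real.log (A τ)) hr φB hφB hexpB hbB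
  have h1 := one_sub_bc_classLaw_le_wild_add_moment hA hB hZA hZB hW
  -- tame moment over `T ∖ W` is at most twice the mixture moment over `T`
  have hsub : ∑ τ ∈ T \ W, (A τ / (∑ σ ∈ T, A σ) + B τ / (∑ σ ∈ T, B σ))
        * ((Real.log (B τ) - Real.log (A τ)) - (Real.log (∑ σ ∈ T, B σ) - Real.log (∑ σ ∈ T, A σ))) ^ 2
      ≤ 2 * ∑ τ ∈ T, (A τ / (∑ σ ∈ T, A σ) + B τ / (∑ σ ∈ T, B σ)) / 2
        * ((Real.log (B τ) - Real.log (A τ)) - (Real.log (∑ σ ∈ T, B σ) - Real.log (∑ σ ∈ T, A σ))) ^ 2 := by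
    rw [mul_sum]
    calc _ ≤ ∑ τ ∈ T, (A τ / (∑ σ ∈ T, A σ) + B τ / (∑ σ ∈ T, B σ))
          * ((Real.log (B τ) - Real.log (A τ)) - (Real.log (∑ σ ∈ T, B σ) - Real.log (∑ σ ∈ T, A σ))) ^ 2 :=
          sum_le_sum_of_subset_of_nonneg sdiff_subset fun τ hτ _ =>
            mul_nonneg (add_nonneg (hp τ hτ) (hq τ hτ)) (sq_nonneg _)
      _ = _ := sum_congr rfl fun τ _ => by ring
  have h8 : (∑ τ ∈ T \ W, (A τ / (∑ σ ∈ T, A σ) + B τ / (∑ σ ∈ T, B σ))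
        * ((Real.log (B τ) - Real.log (A τ)) - (Real.log (∑ σ ∈ T, B σ) - Real.log (∑ σ ∈ T, A σ))) ^ 2) / 8
      ≤ (BA + BB) / r ^ 2 := by
    have hle := hsub.trans (mul_le_mul_of_nonneg_left (hM.trans (add_le_add hVA hVB)) (by norm_num : (0:ℝ) ≤ 2))
    calc _ ≤ 2 * (4 * BA / r ^ 2 + 4 * BB / r ^ 2) / 8 := div_le_div_of_nonneg_right hle (by norm_num)
      _ = (BA + BB) / r ^ 2 := by ring
  linarith

end Tilt

/-! ## §12 (EDITION 3) STRUCTURE ⇒ REPRESENTATION, and the K-SUMMATION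

Two closing pieces of the V-side chain, both [folklore]:

* **Where `hrep` comes from.**  If the keyed classes of ONE run are the compatible sub-families `X ⊆ Λ` of a finite polymer family
  (the run's large-field components at the key), the class weight is MULTIPLICATIVE over components, `A_X = ∏_{γ∈X} a_γ`
  (each `a_γ > 0` already dressed by its own small-field integral), and the increment is ADDITIVE, `h_X = Σ_{γ∈X} u_γ` (a sum of
  local terms), then the tilted class sum IS a polymer partition function with the entire activities `a_γ·e^{s u_γ}`
  (`tilt_classSum_eq_cZ`), and a WEIGHTED real Kotecký–Preiss condition for `a` with the extra factor `e^{r|u_γ|}` gives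
  `IsKPOn` on the closed disc `|s| ≤ r` (`isKPOn_tilt`).  With `|u_γ| ≤ η·(size γ)` and `r = r₀∕η` the extra factor is `e^{r₀·size γ}`:
  absorbed by the run's OWN exponential margin — the two-run letter `η` is spent on the RADIUS only (§11 `…_scaled`).
  Composition: `variance_le_of_multiplicative_kp`.
* **The K-summation.**  Per-key data (wild masses `w_K` with `Σ √w_K < ∞`, radii `r_K` with `Σ 1∕r_K < ∞` — i.e. `r_K = r₀∕η_K`,
  `Σ η_K < ∞` —, one common tilt bound `𝔅`, and the coarse regime from some `K₀` on) give a SUMMABLE rate `ρ_K` dominating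
  `sup_{|t|≤l₀} √(1 − bc_K(t))` (`hellingerRate_of_tilts`): exactly the input shape of §7 `classLawTV_of_hellinger` and of the landed
  per-set-TV road (dag-n20-w4 `exists_hybridNE7_of_target_of_classLawTV`).  HONEST: the summability letters `Σ√w_K`, `Ση_K` are NOT
  proved here or in print for d = 4 two-run data; this section only shows no OTHER letter is consumed on the V-side. -/

section Structure

open Literature.Probability.LatticeModels (IsCompatible polymerPartitionFunction kpTerm IsKPVolume) in
open Literature.MathematicalPhysics.QuantumFieldTheory.Balaban1983to89.T4DilationKP (IsKPOn cZ) in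
/-- **MULTIPLICATIVE CLASS WEIGHTS + ADDITIVE INCREMENT ⇒ THE TILT IS A POLYMER PARTITION FUNCTION** [algebra]:
`Σ_{X ⊆ Λ compatible} (∏_{γ∈X} a_γ)·e^{s·Σ_{γ∈X} u_γ} = Z(Λ; γ ↦ a_γ e^{s u_γ})` (`T4DilationKP.cZ`). -/
theorem tilt_classSum_eq_cZ {P : Type*} [DecidableEq P] (inc : P → P → Prop) [DecidableRel inc]
    (Λ : Finset P) (a u : P → ℝ) (s : ℂ) :
    ∑ X ∈ Λ.powerset with IsCompatible inc X,
        ((∏ γ ∈ X, a γ : ℝ) : ℂ) * Complex.exp (s * ((∑ γ ∈ X, u γ : ℝ) : ℂ))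
      = cZ inc (fun γ s => (a γ : ℂ) * Complex.exp (s * (u γ : ℂ))) Λ s := by
  simp only [cZ, polymerPartitionFunction, Finset.sum_filter]
  refine Finset.sum_congr rfl fun X _ => ?_
  split_ifs with hc
  · push_cast
    rw [Finset.prod_mul_distrib, ← Complex.exp_sum, ← Finset.mul_sum]
  · rfl

open Literature.Probability.LatticeModels (IsCompatible polymerPartitionFunction kpTerm IsKPVolume) in
open Literature.MathematicalPhysics.QuantumFieldTheory.Balaban1983to89.T4DilationKP (IsKPOn cZ) in
/-- **WEIGHTED REAL KP ⇒ KP FOR THE TILTED ACTIVITIES ON THE DISC** [folklore]: if `Σ_{γ'∼γ} a_γ' e^{r|u_γ'|} e^{asz γ'} ≤ asz γ` on `Λ`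
(the run's activities absorb the tilt factor `e^{r|u|}`), then `γ ↦ a_γ e^{s u_γ}` satisfies `IsKPOn` on `|s| ≤ r` with the same size
function — since `‖a_γ e^{s u_γ}‖ = a_γ e^{Re(s) u_γ} ≤ a_γ e^{r|u_γ|}`. -/
theorem isKPOn_tilt {P : Type*} [DecidableEq P] (inc : P → P → Prop) [DecidableRel inc]
    (Λ : Finset P) (a u asz : P → ℝ) (ha : ∀ γ ∈ Λ, 0 ≤ a γ) {r : ℝ}
    (hKPw : ∀ γ ∈ Λ, ∑ γ' ∈ Λ with inc γ' γ, a γ' * Real.exp (r * |u γ'|) * Real.exp (asz γ') ≤ asz γ) :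
    IsKPOn inc (fun γ s => (a γ : ℂ) * Complex.exp (s * (u γ : ℂ))) asz Λ (Metric.closedBall 0 r) := by
  intro s hs γ hγ
  refine le_trans (Finset.sum_le_sum fun γ' hγ' => ?_) (hKPw γ hγ)
  have hγ'Λ : γ' ∈ Λ := (Finset.mem_filter.1 hγ').1
  simp only [kpTerm]
  refine mul_le_mul_of_nonneg_right ?_ (Real.exp_nonneg _)
  rw [norm_mul, Complex.norm_real, Real.norm_eq_abs, abs_of_nonneg (ha γ' hγ'Λ), Complex.norm_exp]
  refine mul_le_mul_of_nonneg_left (Real.exp_le_exp.2 ?_) (ha γ' hγ'Λ)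
  rw [Complex.mul_re, Complex.ofReal_re, Complex.ofReal_im, mul_zero, sub_zero]
  calc s.re * u γ' ≤ |s.re * u γ'| := le_abs_self _
    _ = |s.re| * |u γ'| := abs_mul _ _
    _ ≤ ‖s‖ * |u γ'| := mul_le_mul_of_nonneg_right (Complex.abs_re_le_norm s) (abs_nonneg _)
    _ ≤ r * |u γ'| := mul_le_mul_of_nonneg_right (mem_closedBall_zero_iff.1 hs) (abs_nonneg _)

open Literature.Probability.LatticeModels (IsCompatible polymerPartitionFunction kpTerm IsKPVolume) in
open Literature.MathematicalPhysics.QuantumFieldTheory.Balaban1983to89.T4DilationKP (IsKPOn cZ) in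
/-- **COMPOSITION: ONE-RUN VARIANCE OF AN ADDITIVE INCREMENT OVER A MULTIPLICATIVE KEYED CLASS GAS** [folklore]: under the weighted KP
condition of `isKPOn_tilt` (radius `r > 0`, size function `asz`), the variance of `h_X = Σ_{γ∈X} u_γ` under the class law
`X ↦ ∏_{γ∈X} a_γ ∕ Z` is at most `8·(Σ_{γ∈Λ} asz γ)∕r²` — `variance_le_of_kpTilt` with `hrep` DISCHARGED by `tilt_classSum_eq_cZ`.
The only inputs are ONE run's activities `a`, their KP margin, and the local sizes `|u_γ|` of the increment (entering through `r`). -/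
theorem variance_le_of_multiplicative_kp {P : Type*} [DecidableEq P] (inc : P → P → Prop) [DecidableRel inc]
    [Std.Refl inc] [Std.Symm inc] (Λ : Finset P) (a u asz : P → ℝ) (ha : ∀ γ ∈ Λ, 0 < a γ) {r : ℝ} (hr : 0 < r)
    (hKPw : ∀ γ ∈ Λ, ∑ γ' ∈ Λ with inc γ' γ, a γ' * Real.exp (r * |u γ'|) * Real.exp (asz γ') ≤ asz γ) :
    (∑ X ∈ Λ.powerset with IsCompatible inc X, (∏ γ ∈ X, a γ)
        * ((∑ γ ∈ X, u γ) - (∑ Y ∈ Λ.powerset with IsCompatible inc Y, (∏ γ ∈ Y, a γ) * ∑ γ ∈ Y, u γ)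
            / ∑ Y ∈ Λ.powerset with IsCompatible inc Y, ∏ γ ∈ Y, a γ) ^ 2)
      / (∑ X ∈ Λ.powerset with IsCompatible inc X, ∏ γ ∈ X, a γ)
      ≤ 8 * (∑ γ ∈ Λ, asz γ) / r ^ 2 := by
  have hA : ∀ X ∈ Λ.powerset.filter (fun X => IsCompatible inc X), 0 < ∏ γ ∈ X, a γ := fun X hX =>
    Finset.prod_pos fun γ hγ => ha γ (Finset.mem_powerset.1 (Finset.mem_filter.1 hX).1 hγ)
  have hw : ∀ γ ∈ Λ, DifferentiableOn ℂ ((fun γ s => (a γ : ℂ) * Complex.exp (s * (u γ : ℂ))) γ) (Metric.closedBall 0 r) := by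
    intro γ _
    exact ((differentiable_const _).mul ((differentiable_id.mul (differentiable_const _)).cexp)).differentiableOn
  have e0 := tilt_classSum_eq_cZ inc Λ a u 0
  simp only [zero_mul, Complex.exp_zero, mul_one] at e0
  have key := variance_le_of_kpTilt (inc := inc) (Λ.powerset.filter (fun X => IsCompatible inc X))
    (fun X => ∏ γ ∈ X, a γ) (fun X => ∑ γ ∈ X, u γ) hA hr
    (fun γ s => (a γ : ℂ) * Complex.exp (s * (u γ : ℂ))) asz Λ hw
    (isKPOn_tilt inc Λ a u asz (fun γ hγ => (ha γ hγ).le) hKPw)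
    (fun s _ => by rw [tilt_classSum_eq_cZ inc Λ a u s, e0])
  simpa using key

/-- `√(a + b) ≤ √a + √b` for `a, b ≥ 0`. [folklore] -/
theorem sqrt_add_le_sqrt_add_sqrt {a b : ℝ} (ha : 0 ≤ a) (hb : 0 ≤ b) :
    Real.sqrt (a + b) ≤ Real.sqrt a + Real.sqrt b := by
  have h : a + b ≤ (Real.sqrt a + Real.sqrt b) ^ 2 := by
    nlinarith [Real.sq_sqrt ha, Real.sq_sqrt hb, mul_nonneg (Real.sqrt_nonneg a) (Real.sqrt_nonneg b)]
  calc Real.sqrt (a + b) ≤ Real.sqrt ((Real.sqrt a + Real.sqrt b) ^ 2) := Real.sqrt_le_sqrt h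
    _ = Real.sqrt a + Real.sqrt b := Real.sqrt_sq (add_nonneg (Real.sqrt_nonneg a) (Real.sqrt_nonneg b))

/-- **THE K-SUMMATION OF THE V-SIDE** [folklore]: per-key wild masses `w_K` (`Σ_K √w_K < ∞`), tilt radii `r_K > 0` (`Σ_K 1∕r_K < ∞`),
ONE bound `𝔅` for the analytic tilts of both runs' class laws by the increment at every `(K, t)`, `|t| ≤ l₀`, and the coarse regime
`1 − bc_K(t) ≤ 1∕16` for `K ≥ K₀` give a SUMMABLE sequence `ρ` with `√(1 − bc_K(t)) ≤ ρ_K` for all `K` and `|t| ≤ l₀` — the hypothesis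
shape of `classLawTV_of_hellinger` (§7) ∕ the landed per-set-TV road.  `ρ_K = √w_K + √(2𝔅)∕r_K (+1 on the finite head `K < K₀`)`. -/
theorem hellingerRate_of_tilts [DecidableEq ι] {l₀ : ℝ} (T : ℕ → Finset ι) (A B : ℕ → ℝ → ι → ℝ)
    (hA : ∀ K t, |t| ≤ l₀ → ∀ τ ∈ T K, 0 < A K t τ) (hB : ∀ K t, |t| ≤ l₀ → ∀ τ ∈ T K, 0 < B K t τ)
    (W : ℕ → ℝ → Finset ι) (hW : ∀ K t, W K t ⊆ T K)
    (wm : ℕ → ℝ) (hwm : ∀ K, 0 ≤ wm K)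
    (hwild : ∀ K t, |t| ≤ l₀ →
      (∑ τ ∈ W K t, (A K t τ / (∑ σ ∈ T K, A K t σ) + B K t τ / (∑ σ ∈ T K, B K t σ))) / 2 ≤ wm K)
    (hws : Summable fun K => Real.sqrt (wm K))
    (r : ℕ → ℝ) (hr : ∀ K, 0 < r K) (hrs : Summable fun K => 1 / r K)
    {𝔅 : ℝ} (h𝔅 : 0 ≤ 𝔅)
    (htilt : ∀ K t, |t| ≤ l₀ → ∃ φA φB : ℂ → ℂ,
      DifferentiableOn ℂ φA (Metric.closedBall 0 (r K)) ∧ DifferentiableOn ℂ φB (Metric.closedBall 0 (r K)) ∧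
      (∀ s ∈ Metric.closedBall (0:ℂ) (r K), Complex.exp (φA s)
        = (∑ τ ∈ T K, (A K t τ : ℂ) * Complex.exp (s * ((Real.log (B K t τ) - Real.log (A K t τ) : ℝ) : ℂ)))
            / ∑ τ ∈ T K, (A K t τ : ℂ)) ∧
      (∀ s ∈ Metric.closedBall (0:ℂ) (r K), Complex.exp (φB s)
        = (∑ τ ∈ T K, (B K t τ : ℂ) * Complex.exp (s * ((Real.log (B K t τ) - Real.log (A K t τ) : ℝ) : ℂ)))
            / ∑ τ ∈ T K, (B K t τ : ℂ)) ∧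
      (∀ s ∈ Metric.closedBall (0:ℂ) (r K), ‖φA s‖ ≤ 𝔅) ∧ (∀ s ∈ Metric.closedBall (0:ℂ) (r K), ‖φB s‖ ≤ 𝔅))
    (K₀ : ℕ) (hreg : ∀ K, K₀ ≤ K → ∀ t, |t| ≤ l₀ →
      1 - bc (T K) (fun τ => A K t τ / ∑ σ ∈ T K, A K t σ) (fun τ => B K t τ / ∑ σ ∈ T K, B K t σ) ≤ 1 / 16) :
    ∃ ρ : ℕ → ℝ, Summable ρ ∧ ∀ K t, |t| ≤ l₀ →
      Real.sqrt (1 - bc (T K) (fun τ => A K t τ / ∑ σ ∈ T K, A K t σ) (fun τ => B K t τ / ∑ σ ∈ T K, B K t σ))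
        ≤ ρ K := by
  refine ⟨fun K => Real.sqrt (wm K) + Real.sqrt (2 * 𝔅) * (1 / r K) + (if K < K₀ then (1:ℝ) else 0), ?_, ?_⟩
  · refine (hws.add (hrs.mul_left _)).add ?_
    refine summable_of_ne_finset_zero (s := Finset.range K₀) fun K hK => ?_
    rw [Finset.mem_range] at hK
    simp [hK]
  · intro K t ht
    beta_reduce
    have hbase : 0 ≤ Real.sqrt (wm K) + Real.sqrt (2 * 𝔅) * (1 / r K) :=
      add_nonneg (Real.sqrt_nonneg _) (mul_nonneg (Real.sqrt_nonneg _) (by have := hr K; positivity))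
    have hle1 : Real.sqrt (1 - bc (T K) (fun τ => A K t τ / ∑ σ ∈ T K, A K t σ)
        (fun τ => B K t τ / ∑ σ ∈ T K, B K t σ)) ≤ 1 := by
      have h := Real.sqrt_le_sqrt (show 1 - bc (T K) (fun τ => A K t τ / ∑ σ ∈ T K, A K t σ)
        (fun τ => B K t τ / ∑ σ ∈ T K, B K t σ) ≤ 1 from sub_le_self _ bc_nonneg)
      rwa [Real.sqrt_one] at h
    by_cases hK : K < K₀
    · simp only [hK, if_true]
      linarith
    · simp only [hK, if_false, add_zero]
      obtain ⟨φA, φB, hφA, hφB, heA, heB, hbA, hbB⟩ := htilt K t ht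
      have h1 := one_sub_bc_classLaw_le_wild_add_tilts (T := T K) (hA K t ht) (hB K t ht) (hW K t) (hr K)
        φA φB hφA hφB heA heB hbA hbB (hreg K (not_lt.1 hK) t ht)
      have hx : 1 - bc (T K) (fun τ => A K t τ / ∑ σ ∈ T K, A K t σ) (fun τ => B K t τ / ∑ σ ∈ T K, B K t σ)
          ≤ wm K + 2 * 𝔅 / r K ^ 2 := by
        have h2 := hwild K t ht
        have e : (𝔅 + 𝔅) / r K ^ 2 = 2 * 𝔅 / r K ^ 2 := by ring
        linarith [e ▸ h1]
      calc Real.sqrt (1 - bc (T K) (fun τ => A K t τ / ∑ σ ∈ T K, A K t σ) (fun τ => B K t τ / ∑ σ ∈ T K, B K t σ))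
          ≤ Real.sqrt (wm K + 2 * 𝔅 / r K ^ 2) := Real.sqrt_le_sqrt hx
        _ ≤ Real.sqrt (wm K) + Real.sqrt (2 * 𝔅 / r K ^ 2) :=
            sqrt_add_le_sqrt_add_sqrt (hwm K) (by have := hr K; positivity)
        _ = Real.sqrt (wm K) + Real.sqrt (2 * 𝔅) * (1 / r K) := by
            rw [Real.sqrt_div (by positivity) (r K ^ 2), Real.sqrt_sq (hr K).le]; ring

end Structure

/-! ## §13 (EDITION 4) TAME CONDITIONING — CRIT-1 g5 rider R2 adopted: condition on the tame classes FIRST, tilt SECOND [folklore]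

FINDING F-ed3-1 (CRIT-1 g5, sheet `CRIT-1-TRIAGE-hellinger-free-energy-road-ed3.md` §3): in `one_sub_bc_classLaw_le_wild_add_tilts` (§11) and
`hellingerRate_of_tilts` (§12) the analytic-tilt letter is stated for the FULL class laws (sums over all of `T`, wild classes included), so the
wild set is idle there (the `W = ∅` instance is stronger) and the letter at radius `r₀∕η_K` is NOT what (KR)+(V‑b) supply — on an over-aged
component the increment is `O(p₀)`, not `O(η_K·size)`.  CONCEDED.  REPAIR R2 (CRIT-1, certified in `Crit1ProbeIdea3g12.lean`, namespace
`Summit.QuantumFields.YangMills.Cruxes.SpineGivenEndpointR13SepCoPH.HellingerRoadCrit1`; re-proved below against THIS file's `bc` so that it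
composes with §11–§12): `1 − bc_T(p,q) ≤ max(p(W), q(W)) + (1 − bc_{T∖W}(p|tame, q|tame))`, `p|tame := p∕p(T∖W)`; the conditioned law of a
class law `A∕Z_A` IS the class law of the restricted weights `A|_{T∖W}` (`classLaw_condition_eq_restrict`); so §11's kernel is applied with
`T ↦ T∖W`, `W ↦ ∅` to the restricted weights and the wild masses are added by R2.  For multiplicative keyed weights (§12) the tame classes —
compatible sub-families containing NO over-aged polymer — are exactly the compatible sub-families of `Λ' := Λ ∖ (over-aged polymers)` with the same
product weights, so `tilt_classSum_eq_cZ inc Λ' a u s` represents the tame restricted tilted sums and `isKPOn_tilt` ∕ `variance_le_of_multiplicative_kp`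
apply THERE, where `|u_γ| ≤ η_K·size γ` is (V‑b).  The wild classes enter only through `p(W)`, `q(W)` — each run's OWN over-aged mass, letter (V‑a)
(READ from print in edition 4 of the card: memo `OVERAGE-RATE-READING-idea3-g13.md`).  No new letter enters the bill. -/

section Tame

/-- `√(xy) ≤ (x+y)∕2` for `0 ≤ x, y`. [folklore] -/
theorem sqrt_mul_le_half_add {x y : ℝ} (hx : 0 ≤ x) (hy : 0 ≤ y) : Real.sqrt (x * y) ≤ (x + y) / 2 := by
  have h : x * y ≤ ((x + y) / 2) ^ 2 := by nlinarith [sq_nonneg (x - y)]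
  calc Real.sqrt (x * y) ≤ Real.sqrt (((x + y) / 2) ^ 2) := Real.sqrt_le_sqrt h
    _ = (x + y) / 2 := Real.sqrt_sq (by positivity)

/-- The affinity of two (sub-)probability vectors is at most the mean of their masses. [folklore] -/
theorem bc_le_half_mass (hp : ∀ τ ∈ T, 0 ≤ p τ) (hq : ∀ τ ∈ T, 0 ≤ q τ) :
    bc T p q ≤ ((∑ τ ∈ T, p τ) + ∑ τ ∈ T, q τ) / 2 := by
  unfold bc
  calc ∑ τ ∈ T, Real.sqrt (p τ * q τ) ≤ ∑ τ ∈ T, (p τ + q τ) / 2 :=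
        sum_le_sum fun τ hτ => sqrt_mul_le_half_add (hp τ hτ) (hq τ hτ)
    _ = ((∑ τ ∈ T, p τ) + ∑ τ ∈ T, q τ) / 2 := by rw [← sum_div, sum_add_distrib]

/-- **TAME CONDITIONING** (CRIT-1 g5 rider R2; statement and proof = `HellingerRoadCrit1.one_sub_bc_le_wildMass_add_tame` of the certified probe
`Crit1ProbeIdea3g12.lean`, re-proved here verbatim against this file's `bc`) [folklore]: for two laws `p, q` on `T` and a wild set `W ⊆ T` with
positive tame masses, `1 − bc_T(p,q) ≤ max(p(W), q(W)) + (1 − bc_{T∖W}(p∕p(T∖W), q∕q(T∖W)))` — the Hellinger letter splits into WILD MASS plus the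
Hellinger defect of the TAME-CONDITIONED laws, and only the latter needs tilts. -/
theorem one_sub_bc_le_wildMass_add_tame [DecidableEq ι] {W : Finset ι} (hW : W ⊆ T)
    (hp : ∀ τ ∈ T, 0 ≤ p τ) (hq : ∀ τ ∈ T, 0 ≤ q τ)
    (hp1 : ∑ τ ∈ T, p τ = 1) (hq1 : ∑ τ ∈ T, q τ = 1)
    (hP : 0 < ∑ τ ∈ T \ W, p τ) (hQ : 0 < ∑ τ ∈ T \ W, q τ) :
    1 - bc T p q ≤ max (∑ τ ∈ W, p τ) (∑ τ ∈ W, q τ)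
      + (1 - bc (T \ W) (fun τ => p τ / ∑ σ ∈ T \ W, p σ) (fun τ => q τ / ∑ σ ∈ T \ W, q σ)) := by
  set P := ∑ τ ∈ T \ W, p τ with hPdef
  set Q := ∑ τ ∈ T \ W, q τ with hQdef
  set m := max (∑ τ ∈ W, p τ) (∑ τ ∈ W, q τ) with hmdef
  set b' := bc (T \ W) (fun τ => p τ / P) (fun τ => q τ / Q) with hb'def
  have hPW : P + ∑ τ ∈ W, p τ = 1 := by rw [hPdef, sum_sdiff hW]; exact hp1
  have hQW : Q + ∑ τ ∈ W, q τ = 1 := by rw [hQdef, sum_sdiff hW]; exact hq1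
  have hP1m : 1 - m ≤ P := by have := le_max_left (∑ τ ∈ W, p τ) (∑ τ ∈ W, q τ); linarith
  have hQ1m : 1 - m ≤ Q := by have := le_max_right (∑ τ ∈ W, p τ) (∑ τ ∈ W, q τ); linarith
  have hm0 : 0 ≤ m := le_trans (sum_nonneg fun τ hτ => hp τ (hW hτ)) (le_max_left _ _)
  have hsdp : ∀ τ ∈ T \ W, 0 ≤ p τ := fun τ hτ => hp τ (sdiff_subset hτ)
  have hsdq : ∀ τ ∈ T \ W, 0 ≤ q τ := fun τ hτ => hq τ (sdiff_subset hτ)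
  have hPQ : 0 < P * Q := mul_pos hP hQ
  have hb'eq : b' = (∑ τ ∈ T \ W, Real.sqrt (p τ * q τ)) / Real.sqrt (P * Q) := by
    rw [hb'def, bc, sum_div]
    refine sum_congr rfl fun τ _ => ?_
    rw [div_mul_div_comm, Real.sqrt_div' _ hPQ.le]
  have hS : ∑ τ ∈ T \ W, Real.sqrt (p τ * q τ) = b' * Real.sqrt (P * Q) := by
    rw [hb'eq, div_mul_cancel₀ _ (Real.sqrt_pos.2 hPQ).ne']
  have hsplit : bc T p q = ∑ τ ∈ T \ W, Real.sqrt (p τ * q τ) + ∑ τ ∈ W, Real.sqrt (p τ * q τ) := by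
    rw [bc, sum_sdiff hW]
  have hWnn : 0 ≤ ∑ τ ∈ W, Real.sqrt (p τ * q τ) := sum_nonneg fun _ _ => Real.sqrt_nonneg _
  have hb'0 : 0 ≤ b' := bc_nonneg
  have hb'1 : b' ≤ 1 := by
    have h := bc_le_half_mass (T := T \ W) (p := fun τ => p τ / P) (q := fun τ => q τ / Q)
      (fun τ hτ => div_nonneg (hsdp τ hτ) hP.le) (fun τ hτ => div_nonneg (hsdq τ hτ) hQ.le)
    have e1 : ∑ τ ∈ T \ W, p τ / P = 1 := by rw [← sum_div, div_self hP.ne']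
    have e2 : ∑ τ ∈ T \ W, q τ / Q = 1 := by rw [← sum_div, div_self hQ.ne']
    rw [e1, e2] at h; rw [hb'def]; linarith
  rcases le_or_gt m 1 with hm1 | hm1
  · have hsq : 1 - m ≤ Real.sqrt (P * Q) := by
      have hmul : (1 - m) * (1 - m) ≤ P * Q := mul_le_mul hP1m hQ1m (by linarith) hP.le
      calc 1 - m = Real.sqrt ((1 - m) ^ 2) := (Real.sqrt_sq (by linarith)).symm
        _ ≤ Real.sqrt (P * Q) := Real.sqrt_le_sqrt (by nlinarith [hmul])
    have h1 : b' * (1 - m) ≤ bc T p q := by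
      rw [hsplit, hS]
      have := mul_le_mul_of_nonneg_left hsq hb'0
      linarith
    nlinarith [h1, hb'1, hm0]
  · have : bc T p q ≥ 0 := bc_nonneg
    linarith

/-- Conditioning a class law on the tame classes IS the class law of the RESTRICTED weights:
`(A_τ∕Z_A) ∕ (Σ_{σ∈T∖W} A_σ∕Z_A) = A_τ ∕ Σ_{σ∈T∖W} A_σ`. -/
theorem classLaw_condition_eq_restrict [DecidableEq ι] {A : ι → ℝ} {W : Finset ι} (hZA : (∑ σ ∈ T, A σ) ≠ 0) :
    (fun τ => (A τ / ∑ σ ∈ T, A σ) / ∑ σ ∈ T \ W, (A σ / ∑ σ' ∈ T, A σ')) = fun τ => A τ / ∑ σ ∈ T \ W, A σ := by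
  funext τ
  rw [← sum_div, div_div_div_cancel_right₀ hZA]

/-- **THE TAME REGIME FROM COARSE DATA** [folklore]: a UNIFORM closeness `|h_τ − c_tame| ≤ ¼` of the tame-centred increment on the tame classes
(`c_tame = log Σ_{T∖W} B − log Σ_{T∖W} A`) gives `1 − bc_{T∖W} ≤ 1∕16` for the tame-restricted class laws (`regime_of_wild_add_sup` with `T ↦ T∖W`,
`W ↦ ∅`). -/
theorem regime_tame_of_sup [DecidableEq ι] {A B : ι → ℝ} {W : Finset ι}
    (hA : ∀ τ ∈ T \ W, 0 < A τ) (hB : ∀ τ ∈ T \ W, 0 < B τ) (hne : (T \ W).Nonempty)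
    (hsup : ∀ τ ∈ T \ W, |(Real.log (B τ) - Real.log (A τ))
      - (Real.log (∑ σ ∈ T \ W, B σ) - Real.log (∑ σ ∈ T \ W, A σ))| ≤ 1 / 4) :
    1 - bc (T \ W) (fun τ => A τ / ∑ σ ∈ T \ W, A σ) (fun τ => B τ / ∑ σ ∈ T \ W, B σ) ≤ 1 / 16 :=
  regime_of_wild_add_sup (T := T \ W) hA hB (sum_pos hA hne) (sum_pos hB hne) (W := ∅) (Finset.empty_subset _)
    (by norm_num [Finset.sum_empty]) (fun τ hτ => hsup τ (by simpa using hτ))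

/-- **THE ONE-`(K,t)` V-SIDE KERNEL, TAME-CONDITIONED** (EDITION 4, R2) [folklore]: for positive class weights `A, B` of the two runs on `T`, a
wild set `W ⊆ T`, analytic tilts of both runs' TAME-RESTRICTED class laws (sums over `T ∖ W` only) by the increment `h = log B − log A` with common
radius `r` and bounds `B_A, B_B`, in the tame regime `1 − bc_{T∖W} ≤ 1∕16` (`regime_tame_of_sup`):
`1 − bc_T(A∕Z_A, B∕Z_B) ≤ max(p(W), q(W)) + (B_A + B_B)∕r²` — each run's OWN over-aged mass, plus tilt bounds that see tame classes only.
(Wild classes: paid by mass and nothing more — now literally.) -/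
theorem one_sub_bc_classLaw_le_wildMass_add_tameTilts [DecidableEq ι] {A B : ι → ℝ}
    (hA : ∀ τ ∈ T, 0 < A τ) (hB : ∀ τ ∈ T, 0 < B τ) {W : Finset ι} (hW : W ⊆ T)
    {r BA BB : ℝ} (hr : 0 < r) (φA φB : ℂ → ℂ)
    (hφA : DifferentiableOn ℂ φA (Metric.closedBall 0 r)) (hφB : DifferentiableOn ℂ φB (Metric.closedBall 0 r))
    (hexpA : ∀ s ∈ Metric.closedBall (0:ℂ) r, Complex.exp (φA s)
      = (∑ τ ∈ T \ W, (A τ : ℂ) * Complex.exp (s * ((Real.log (B τ) - Real.log (A τ) : ℝ) : ℂ))) / ∑ τ ∈ T \ W, (A τ : ℂ))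
    (hexpB : ∀ s ∈ Metric.closedBall (0:ℂ) r, Complex.exp (φB s)
      = (∑ τ ∈ T \ W, (B τ : ℂ) * Complex.exp (s * ((Real.log (B τ) - Real.log (A τ) : ℝ) : ℂ))) / ∑ τ ∈ T \ W, (B τ : ℂ))
    (hbA : ∀ s ∈ Metric.closedBall (0:ℂ) r, ‖φA s‖ ≤ BA) (hbB : ∀ s ∈ Metric.closedBall (0:ℂ) r, ‖φB s‖ ≤ BB)
    (hreg : 1 - bc (T \ W) (fun τ => A τ / ∑ σ ∈ T \ W, A σ) (fun τ => B τ / ∑ σ ∈ T \ W, B σ) ≤ 1 / 16) :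
    1 - bc T (fun τ => A τ / ∑ σ ∈ T, A σ) (fun τ => B τ / ∑ σ ∈ T, B σ)
      ≤ max (∑ τ ∈ W, A τ / ∑ σ ∈ T, A σ) (∑ τ ∈ W, B τ / ∑ σ ∈ T, B σ) + (BA + BB) / r ^ 2 := by
  have hA' : ∀ τ ∈ T \ W, 0 < A τ := fun τ hτ => hA τ (sdiff_subset hτ)
  have hB' : ∀ τ ∈ T \ W, 0 < B τ := fun τ hτ => hB τ (sdiff_subset hτ)
  -- the tame set is nonempty (else `bc_{T∖W} = 0` and the regime hypothesis reads `1 ≤ 1∕16`)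
  have hne' : (T \ W).Nonempty := by
    by_contra h
    rw [Finset.not_nonempty_iff_eq_empty] at h
    have e : bc (T \ W) (fun τ => A τ / ∑ σ ∈ T \ W, A σ) (fun τ => B τ / ∑ σ ∈ T \ W, B σ) = 0 := by rw [h]; simp [bc]
    rw [e] at hreg; norm_num at hreg
  have hZA : 0 < ∑ τ ∈ T, A τ := sum_pos hA (hne'.mono sdiff_subset)
  have hZB : 0 < ∑ τ ∈ T, B τ := sum_pos hB (hne'.mono sdiff_subset)
  have hZA' : 0 < ∑ τ ∈ T \ W, A τ := sum_pos hA' hne'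
  have hZB' : 0 < ∑ τ ∈ T \ W, B τ := sum_pos hB' hne'
  have hp : ∀ τ ∈ T, 0 ≤ A τ / ∑ σ ∈ T, A σ := fun τ hτ => div_nonneg (hA τ hτ).le hZA.le
  have hq : ∀ τ ∈ T, 0 ≤ B τ / ∑ σ ∈ T, B σ := fun τ hτ => div_nonneg (hB τ hτ).le hZB.le
  have hp1 : ∑ τ ∈ T, A τ / ∑ σ ∈ T, A σ = 1 := by rw [← sum_div, div_self hZA.ne']
  have hq1 : ∑ τ ∈ T, B τ / ∑ σ ∈ T, B σ = 1 := by rw [← sum_div, div_self hZB.ne']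
  have hP : 0 < ∑ τ ∈ T \ W, A τ / ∑ σ ∈ T, A σ := by rw [← sum_div]; exact div_pos hZA' hZA
  have hQ : 0 < ∑ τ ∈ T \ W, B τ / ∑ σ ∈ T, B σ := by rw [← sum_div]; exact div_pos hZB' hZB
  -- R2: wild masses + Hellinger defect of the tame-conditioned laws
  have hsplit : 1 - bc T (fun τ => A τ / ∑ σ ∈ T, A σ) (fun τ => B τ / ∑ σ ∈ T, B σ)
      ≤ max (∑ τ ∈ W, A τ / ∑ σ ∈ T, A σ) (∑ τ ∈ W, B τ / ∑ σ ∈ T, B σ)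
        + (1 - bc (T \ W) (fun τ => (A τ / ∑ σ ∈ T, A σ) / ∑ σ ∈ T \ W, (A σ / ∑ σ' ∈ T, A σ'))
            (fun τ => (B τ / ∑ σ ∈ T, B σ) / ∑ σ ∈ T \ W, (B σ / ∑ σ' ∈ T, B σ'))) :=
    one_sub_bc_le_wildMass_add_tame (T := T) (p := fun τ => A τ / ∑ σ ∈ T, A σ) (q := fun τ => B τ / ∑ σ ∈ T, B σ)
      hW hp hq hp1 hq1 hP hQ
  -- the conditioned laws ARE the class laws of the restricted weights
  have key : bc (T \ W) (fun τ => (A τ / ∑ σ ∈ T, A σ) / ∑ σ ∈ T \ W, (A σ / ∑ σ' ∈ T, A σ'))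
        (fun τ => (B τ / ∑ σ ∈ T, B σ) / ∑ σ ∈ T \ W, (B σ / ∑ σ' ∈ T, B σ'))
      = bc (T \ W) (fun τ => A τ / ∑ σ ∈ T \ W, A σ) (fun τ => B τ / ∑ σ ∈ T \ W, B σ) := by
    rw [classLaw_condition_eq_restrict hZA.ne', classLaw_condition_eq_restrict hZB.ne']
  -- §11's kernel on the restricted weights, with an empty wild set
  have htame : 1 - bc (T \ W) (fun τ => A τ / ∑ σ ∈ T \ W, A σ) (fun τ => B τ / ∑ σ ∈ T \ W, B σ)
      ≤ (∑ τ ∈ (∅ : Finset ι), (A τ / (∑ σ ∈ T \ W, A σ) + B τ / (∑ σ ∈ T \ W, B σ))) / 2 + (BA + BB) / r ^ 2 :=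
    one_sub_bc_classLaw_le_wild_add_tilts (T := T \ W) hA' hB' (W := ∅) (Finset.empty_subset _) hr
      φA φB hφA hφB hexpA hexpB hbA hbB hreg
  rw [Finset.sum_empty, zero_div, zero_add] at htame
  rw [key] at hsplit
  linarith

/-- **THE K-SUMMATION OF THE V-SIDE, TAME-CONDITIONED** (EDITION 4, R2) [folklore]: per key `K` and source `|t| ≤ l₀`, each run's OWN over-aged
(wild) mass `p_K(W_K t), q_K(W_K t) ≤ w_K` with `Σ_K √w_K < ∞` — letter (V‑a), ONE-RUN, read from print in the card's edition 4 —, tilt radii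
`r_K > 0` with `Σ_K 1∕r_K < ∞` (`r_K = r₀∕η_K`, `Ση_K < ∞` = (V‑b) on TAME components), ONE bound `𝔅` for the analytic tilts of both runs'
TAME-RESTRICTED class laws at every `(K,t)`, and the tame regime `1 − bc_{T∖W} ≤ 1∕16` for `K ≥ K₀` give a SUMMABLE `ρ` with
`√(1 − bc_K(t)) ≤ ρ_K` for all `K`, `|t| ≤ l₀` — the hypothesis shape of `classLawTV_of_hellinger` (§7) ∕ the landed per-set-TV road.
`ρ_K = √w_K + √(2𝔅)∕r_K (+1 on K < K₀)`.  Supersedes `hellingerRate_of_tilts` as the load-bearing K-summation. -/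
theorem hellingerRate_of_tameTilts [DecidableEq ι] {l₀ : ℝ} (T : ℕ → Finset ι) (A B : ℕ → ℝ → ι → ℝ)
    (hA : ∀ K t, |t| ≤ l₀ → ∀ τ ∈ T K, 0 < A K t τ) (hB : ∀ K t, |t| ≤ l₀ → ∀ τ ∈ T K, 0 < B K t τ)
    (W : ℕ → ℝ → Finset ι) (hW : ∀ K t, W K t ⊆ T K)
    (wm : ℕ → ℝ) (hwm : ∀ K, 0 ≤ wm K)
    (hwildA : ∀ K t, |t| ≤ l₀ → ∑ τ ∈ W K t, A K t τ / (∑ σ ∈ T K, A K t σ) ≤ wm K)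
    (hwildB : ∀ K t, |t| ≤ l₀ → ∑ τ ∈ W K t, B K t τ / (∑ σ ∈ T K, B K t σ) ≤ wm K)
    (hws : Summable fun K => Real.sqrt (wm K))
    (r : ℕ → ℝ) (hr : ∀ K, 0 < r K) (hrs : Summable fun K => 1 / r K)
    {𝔅 : ℝ} (h𝔅 : 0 ≤ 𝔅)
    (htilt : ∀ K t, |t| ≤ l₀ → ∃ φA φB : ℂ → ℂ,
      DifferentiableOn ℂ φA (Metric.closedBall 0 (r K)) ∧ DifferentiableOn ℂ φB (Metric.closedBall 0 (r K)) ∧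
      (∀ s ∈ Metric.closedBall (0:ℂ) (r K), Complex.exp (φA s)
        = (∑ τ ∈ T K \ W K t, (A K t τ : ℂ) * Complex.exp (s * ((Real.log (B K t τ) - Real.log (A K t τ) : ℝ) : ℂ)))
            / ∑ τ ∈ T K \ W K t, (A K t τ : ℂ)) ∧
      (∀ s ∈ Metric.closedBall (0:ℂ) (r K), Complex.exp (φB s)
        = (∑ τ ∈ T K \ W K t, (B K t τ : ℂ) * Complex.exp (s * ((Real.log (B K t τ) - Real.log (A K t τ) : ℝ) : ℂ)))
            / ∑ τ ∈ T K \ W K t, (B K t τ : ℂ)) ∧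
      (∀ s ∈ Metric.closedBall (0:ℂ) (r K), ‖φA s‖ ≤ 𝔅) ∧ (∀ s ∈ Metric.closedBall (0:ℂ) (r K), ‖φB s‖ ≤ 𝔅))
    (K₀ : ℕ) (hreg : ∀ K, K₀ ≤ K → ∀ t, |t| ≤ l₀ →
      1 - bc (T K \ W K t) (fun τ => A K t τ / ∑ σ ∈ T K \ W K t, A K t σ)
        (fun τ => B K t τ / ∑ σ ∈ T K \ W K t, B K t σ) ≤ 1 / 16) :
    ∃ ρ : ℕ → ℝ, Summable ρ ∧ ∀ K t, |t| ≤ l₀ →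
      Real.sqrt (1 - bc (T K) (fun τ => A K t τ / ∑ σ ∈ T K, A K t σ) (fun τ => B K t τ / ∑ σ ∈ T K, B K t σ))
        ≤ ρ K := by
  refine ⟨fun K => Real.sqrt (wm K) + Real.sqrt (2 * 𝔅) * (1 / r K) + (if K < K₀ then (1:ℝ) else 0), ?_, ?_⟩
  · refine (hws.add (hrs.mul_left _)).add ?_
    refine summable_of_ne_finset_zero (s := Finset.range K₀) fun K hK => ?_
    rw [Finset.mem_range] at hK
    simp [hK]
  · intro K t ht
    beta_reduce
    have hbase : 0 ≤ Real.sqrt (wm K) + Real.sqrt (2 * 𝔅) * (1 / r K) :=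
      add_nonneg (Real.sqrt_nonneg _) (mul_nonneg (Real.sqrt_nonneg _) (by have := hr K; positivity))
    have hle1 : Real.sqrt (1 - bc (T K) (fun τ => A K t τ / ∑ σ ∈ T K, A K t σ)
        (fun τ => B K t τ / ∑ σ ∈ T K, B K t σ)) ≤ 1 := by
      have h := Real.sqrt_le_sqrt (show 1 - bc (T K) (fun τ => A K t τ / ∑ σ ∈ T K, A K t σ)
        (fun τ => B K t τ / ∑ σ ∈ T K, B K t σ) ≤ 1 from sub_le_self _ bc_nonneg)
      rwa [Real.sqrt_one] at h
    by_cases hK : K < K₀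
    · simp only [hK, if_true]
      linarith
    · simp only [hK, if_false, add_zero]
      obtain ⟨φA, φB, hφA, hφB, heA, heB, hbA, hbB⟩ := htilt K t ht
      have h1 := one_sub_bc_classLaw_le_wildMass_add_tameTilts (T := T K) (hA K t ht) (hB K t ht) (hW K t) (hr K)
        φA φB hφA hφB heA heB hbA hbB (hreg K (not_lt.1 hK) t ht)
      have hx : 1 - bc (T K) (fun τ => A K t τ / ∑ σ ∈ T K, A K t σ) (fun τ => B K t τ / ∑ σ ∈ T K, B K t σ)
          ≤ wm K + 2 * 𝔅 / r K ^ 2 := by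
        have h2 := max_le (hwildA K t ht) (hwildB K t ht)
        have e : (𝔅 + 𝔅) / r K ^ 2 = 2 * 𝔅 / r K ^ 2 := by ring
        linarith [e ▸ h1]
      calc Real.sqrt (1 - bc (T K) (fun τ => A K t τ / ∑ σ ∈ T K, A K t σ) (fun τ => B K t τ / ∑ σ ∈ T K, B K t σ))
          ≤ Real.sqrt (wm K + 2 * 𝔅 / r K ^ 2) := Real.sqrt_le_sqrt hx
        _ ≤ Real.sqrt (wm K) + Real.sqrt (2 * 𝔅 / r K ^ 2) :=
            sqrt_add_le_sqrt_add_sqrt (hwm K) (by have := hr K; positivity)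
        _ = Real.sqrt (wm K) + Real.sqrt (2 * 𝔅) * (1 / r K) := by
            rw [Real.sqrt_div (by positivity) (r K ^ 2), Real.sqrt_sq (hr K).le]; ring

end Tame

/-! ## §9 Toys -/

/-- identical laws have affinity one … -/
example : bc (Finset.univ : Finset Bool) (ber (1/2)) (ber (1/2)) = 1 := by
  rw [bc_ber]
  have h : Real.sqrt ((1:ℝ)/2 * (1/2)) = 1/2 := by
    rw [Real.sqrt_eq_iff_mul_self_eq (by norm_num) (by norm_num)]
  norm_num [h]

/-- … and disjointly supported laws have affinity zero (the Kakutani-singular end). -/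
example : bc (Finset.univ : Finset Bool) (ber 1) (ber 0) = 0 := by
  rw [bc_ber]; simp

end Laws

end YMNodeOIdeate.Idea3.HellingerRoad
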